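import Mathlib
import HarnessLib
import Literature.Combinatorics.Additive.OptimallySmallSumsets
import Literature.GroupTheory.FiniteAbelian.SubgroupsOfAllOrders

/-!
# Sets with few differences in elementary abelian `p`-groups (Lee 2018, Main Theorem):
# `ρ⁻_{(ℤ/p)^d}(r) = p^t · min{2⌈r/p^t⌉ − 1, p}` for `p^t < r ≤ p^{t+1}`

Topic `Literature/Combinatorics/Additive`.  Cell `mm-stpp` (D-0046), seat `mm-stpp-lit` (gen 10).  Companion of
`OptimallySmallSumsets.lean`, which holds the Eliahou–Kervaire–Plagne function `μ_G`, the identity `ρ⁺_G = μ_G`,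
`ρ⁻ ≥ μ` everywhere, `ρ⁻ = μ` in cyclic groups and Lee's coset-progression upper bound `ρ⁻ ≤ D*`
(`exists_card_sub_self_le_of_addSubgroup`); the one printed EXACT value of the one-set difference function
`ρ⁻_G(r) = min{|A − A| : A ⊆ G, |A| = r}` in a non-cyclic family — the quantity behind the cell's size budgets
`knLB` / `kneser_budget` for one-set difference classes (LIT-INDEX §8 N31′) — is vendored and PROVED here.

**Theorem (M. Lee, Electron. J. Combin. 25(3) (2018) P3.22, "Theorem (main)").**  Let `G = (ℤ/p)^d`, `p` prime,
`0 ≤ t ≤ d` and `p^t < r ≤ p^{t+1}`.  Then `ρ⁻_G(r) = p^t · min{2⌈r/p^t⌉ − 1, p}`.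

Stated here for EVERY finite `𝔽_p`-vector space `V` (`Module (ZMod p) V`, `Fintype V`; so `Fin d → ZMod p`, and any
finite abelian group of exponent `p` via `AddCommGroup.zmodModule`), with `⌈r/q⌉ = (r + q − 1)/q`:
* `leeBound p t r = p^t * min (2 * ⌈r/p^t⌉ − 1) p` (definition + `leeBound_def`, `leeBound_le_pow`);
* LOWER BOUND `leeBound_le_card_sub (A : Finset V) (t) : p^t < #A → #A ≤ p^(t+1) → leeBound p t #A ≤ #(A − A)`
  (no hypothesis on `dim V`; `leeBound_le_card_sub_of_exponent` for a bare `AddCommGroup` with `p • x = 0`);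
* ATTAINMENT `exists_card_sub_self_le_leeBound : p^t < r → r ≤ p^(t+1) → r ≤ |V| → ∃ A, #A = r ∧ #(A − A) ≤ leeBound`
  (Lee's Lemma 1 = the tree's coset-progression lemma for a subgroup of order `p^t` with `c = ⌈r/p^t⌉`, or of
  order `p^{t+1}` with `c = 1`);
* the EQUALITY `lee_main` (both halves) and `lee_main_pi` (for `Fin d → ZMod p`, `t < d`).

The proof FOLLOWS THE PRINTED ONE (Lee §§4–7 and the Appendix), each step an internal lemma of the namespace
`Literature.Combinatorics.Additive.FewDifferences`, in cardinality language (`|V| = p^d` instead of `dim V = d`):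
* Appendix Lemma 6 (`three_mul_sum_le_sum_add_three`: `∑ μ_k ≥ 3∑λ_k − 3`) and the "sum lemma" of §6
  (`sumlemma`: `∑ μ_k ≥ (2n+1)p`), as subtraction-free statements about `ℕ`-sequences.  DEVIATIONS: Lemma 6 is
  proved by the index shift of Lee's own Case 8 (drop the longest row, induct on the number of rows) instead of
  Freiman's `|F + F| ≥ 3|F| − 3` for the Ferrers diagram — same statement, shorter road; in the sum lemma the
  induction is on `n`, and the sub-case `n = 1` of Case 8 (`h ≥ 2`), where the printed text invokes the inductive
  hypothesis at `n − 1 = 0` (not covered by the lemma, and false there: `λ = (1,…,1)`), is settled directly by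
  `μ₃ ≥ λ₁` (pair `(1,3)`) and `μ_{m+1} ≥ λ₂` (pair `(2,m)`), both available because `m ≥ n + 2 = 3` is a
  hypothesis of `sumlemma`; every other displayed chain of the printed Appendix (Cases 6–8) is used as it stands.
* Lemma 2 (independence of dimension): `exists_smul_ne` (a line through `0` meeting `A − A` only in `0`, by
  counting: `1 + (p−1)(|A−A|−1) < p^d`) and `injOn_mkQ` (the quotient by that line is injective on `A`); used in
  `leeBound_le_card_sub` to descend from `|V| = p^{t+1+k}` to `|V| = p^{t+1}` (`card_quotient_span`).
* Lemma 4 (hyperplane intersection lemma, `d ≥ 3`): `le_card_of_forall_dual`.  DEVIATION: Lee picks a uniformly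
  random `(d−2)`-subspace `V₀` with `E|S ∩ V₀| < m p^{d−3} + 1`; we obtain such a `V₀ = ker f₁ ∩ ker g` by TWO
  successive averaging steps over hyperplanes (`exists_dual_sparse`, counting functionals vanishing at a nonzero
  vector, `card_dual_vanishing_mul`) — the composite bound is the same — and then run his count over the `p + 1`
  hyperplanes through `V₀` (the pencil `a f₁ + b g`, `(a,b) ≠ 0`; `card_filter_lin_eq`, `eq_zero_of_lin_comb`),
  finishing with the printed arithmetic (`key_ineq`).
* Lemma 3 (the case `p < r ≤ p²`, `d = 2`): `two_dim` for `A ⊆ ZMod p × ZMod p` — `p = 2` by enumeration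
  (`two_dim_two`, `decide`), `p` odd: reduction to `|A| = np + 1`, choice of a direction carrying at least the
  average number of pairs (`sum_card_pairs_dir` = Lee's `∑_ℓ C(|A∩ℓ|,2) = C(|A|,2)` in ordered form, `exists_good_dir`),
  a linear change of coordinates making it vertical (`dirT`, `card_vertical_pairs_image`), and the three cases of
  the printed proof on the columns `col A x` (`two_dim_vertical`: Case 1 fat column, Case 2 via `case_two_arith`
  and `S − S = 𝔽_p`, Case 3 via `sumlemma`), Cauchy–Davenport being Mathlib's `ZMod.cauchy_davenport`.
* Thm (main): `core_dim` (spaces with `|V| = p^{t+1}`, strong induction on `t`: `t = 0` Cauchy–Davenport via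
  `V ≃ₗ ZMod p`, `t = 1` Lemma 3 via `V ≃ₗ ZMod p × ZMod p`, `t ≥ 2` Lemma 4 with the inductive hypothesis in the
  hyperplanes `ker f`, `card_ker`, and `⌈⌈r/p⌉/p^{t−1}⌉ = ⌈r/p^t⌉`, `ceilDiv_ceilDiv`), then `leeBound_le_card_sub`.
All sorry-free; no named facts; axioms `propext`, `Classical.choice`, `Quot.sound`.

WHAT THIS FILE IS NOT: nothing about `ρ⁻_G` for abelian `p`-groups that are not elementary or for mixed orders —
Lee's Conjecture 1 (`ρ⁻_G(r) = min_{d ∈ D(N,e,r)} d(2⌈r/d⌉ − 1)`) is printed as OPEN outside cyclic groups and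
`(ℤ/p)^d` and is not formalised (its `≤` half is `exists_card_sub_self_le_of_addSubgroup`); no `h`-fold signed
sumsets (Bajnok–Matzke; Lee §8 is not ported); no statement about the cell's census, thresholds or `ω`.

## References
* M. Lee, *Sets with few differences in abelian groups*, Electron. J. Combin. 25(3) (2018) P3.22,
  doi:10.37236/5502 = arXiv:1508.05524 — held `paper:arxiv-1508.05524`; p0003 (statements), p0005 (§3, §4 Lemma 1,
  Remark 5), p0006–p0010 (§5 Lemma 2, §6 Lemma 3 with Cases 1–3, §7 Lemma 4 and the proof of the Main Theorem),
  p0012–p0013 (Appendix: Lemma 6, proof of the sum lemma) read 2026-08-27 [cite: Lee2018, Thm (main)]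
  [cite: Lee2018, Lemma 2] [cite: Lee2018, Lemma 3] [cite: Lee2018, Lemma 4] [cite: Lee2018, Appendix Lemma 6].
* B. Bajnok, R. Matzke, *On the minimum size of signed sumsets in elementary abelian groups*, J. Number Theory 159
  (2016) 384–401 — held `paper:arxiv-1412.1609` (the conjecture Lee's theorem settles; not used).
* A.-L. Cauchy (1813) / H. Davenport (1935): Cauchy–Davenport, via Mathlib `ZMod.cauchy_davenport` [folklore].
-/

namespace Literature.Combinatorics.Additive
namespace FewDifferences

open Finset Module
open scoped Pointwise


/-- **Lee 2018, Appendix Lemma 6 (lower-bound form, 0-indexed).**  Let `m ≥ 2`, let `a 0 ≥ a 1 ≥ ⋯ ≥ a (m-1) ≥ 1`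
with `a 0 ≥ 2`, and let `u` satisfy `a i + a j ≤ u (i + j) + 1` for all `i, j < m` (Lee: `μ_{i+j-1} ≥ λ_i + λ_j − 1`).
Then `3 ∑_{i<m} a i ≤ ∑_{k<2m-1} u k + 3`.  (Lee proves this with Freiman's `|F + F| ≥ 3|F| − 3` for the Ferrers
diagram of `λ`; we use instead the index shift of his Case 8: drop the first row and induct on `m`.) [cite: Lee2018, Appendix Lemma 6] -/
theorem three_mul_sum_le_sum_add_three :
    ∀ (m : ℕ) (a u : ℕ → ℕ), 2 ≤ m → (∀ i j, i ≤ j → j < m → a j ≤ a i) → (∀ i, i < m → 1 ≤ a i) →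
      2 ≤ a 0 → (∀ i j, i < m → j < m → a i + a j ≤ u (i + j) + 1) →
      3 * ∑ i ∈ range m, a i ≤ ∑ k ∈ range (2 * m - 1), u k + 3 := by
  intro m
  induction m using Nat.strong_induction_on with
  | _ m ih =>
  intro a u hm hanti hpos ha0 hu
  obtain ⟨m', rfl⟩ : ∃ m', m = m' + 2 := ⟨m - 2, by omega⟩
  rcases Nat.eq_zero_or_pos m' with hm' | hm'
  · -- `m = 2`
    subst hm'
    have h00 := hu 0 0 (by omega) (by omega)
    have h01 := hu 0 1 (by omega) (by omega)
    have h11 := hu 1 1 (by omega) (by omega)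
    have ha1 := hpos 1 (by omega)
    simp only [Nat.reduceAdd, Nat.reduceMul, Nat.reduceSub, sum_range_succ, sum_range_zero, zero_add] at h00 h01 h11 ⊢
    omega
  · by_cases ha1 : a 1 = 1
    · -- all rows after the first have length `1`
      have hai : ∀ i, 1 ≤ i → i < m' + 2 → a i = 1 := fun i hi him =>
        le_antisymm (ha1 ▸ hanti 1 i hi him) (hpos i him)
      have hsa : ∑ i ∈ range (m' + 2), a i = a 0 + (m' + 1) := by
        rw [Finset.sum_range_succ']
        rw [Finset.sum_congr rfl (fun i hi => hai (i + 1) (by omega) (by simp at hi; omega))]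
        simp [add_comm]
      have hsplit : ∑ k ∈ range (2 * (m' + 2) - 1), u k =
          (∑ k ∈ range (m' + 1), u (k + 1) + u 0) + ∑ k ∈ range (m' + 1), u (m' + 2 + k) := by
        have e : 2 * (m' + 2) - 1 = (m' + 2) + (m' + 1) := by omega
        rw [e, Finset.sum_range_add, Finset.sum_range_succ']
      have h0 : 2 * a 0 ≤ u 0 + 1 := by simpa [two_mul] using hu 0 0 (by omega) (by omega)
      have h1 : ∀ k ∈ range (m' + 1), a 0 + 1 ≤ u (k + 1) + 1 := by
        intro k hk
        simp only [mem_range] at hk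
        have := hu 0 (k + 1) (by omega) (by omega)
        rwa [hai (k + 1) (by omega) (by omega), zero_add] at this
      have h2 : ∀ k ∈ range (m' + 1), 2 ≤ u (m' + 2 + k) + 1 := by
        intro k hk
        simp only [mem_range] at hk
        have := hu (k + 1) (m' + 1) (by omega) (by omega)
        rw [hai (k + 1) (by omega) (by omega), hai (m' + 1) (by omega) (by omega)] at this
        have e : k + 1 + (m' + 1) = m' + 2 + k := by omega
        rwa [e] at this
      have hs1 := Finset.sum_le_sum h1
      have hs2 := Finset.sum_le_sum h2
      simp only [sum_const, card_range, smul_eq_mul, Finset.sum_add_distrib] at hs1 hs2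
      rw [hsplit, hsa]
      have key : m' * 2 ≤ m' * a 0 := Nat.mul_le_mul_left _ ha0
      nlinarith [hs1, hs2, h0, key, hm']
    · -- `a 1 ≥ 2`: drop the first row and use the induction hypothesis
      have ha1' : 2 ≤ a 1 := by have := hpos 1 (by omega); omega
      have hih := ih (m' + 1) (by omega) (fun i => a (i + 1)) (fun k => u (k + 2)) (by omega)
        (fun i j hij hj => hanti (i + 1) (j + 1) (by omega) (by omega))
        (fun i hi => hpos (i + 1) (by omega)) ha1'
        (fun i j hi hj => by
          have := hu (i + 1) (j + 1) (by omega) (by omega)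
          rwa [show i + 1 + (j + 1) = i + j + 2 by ring] at this)
      have hsplit : ∑ k ∈ range (2 * (m' + 2) - 1), u k =
          (∑ k ∈ range (2 * (m' + 1) - 1), u (k + 2) + u (0 + 1)) + u 0 := by
        have e : 2 * (m' + 2) - 1 = (2 * (m' + 1) - 1) + 1 + 1 := by omega
        rw [e, Finset.sum_range_succ', Finset.sum_range_succ']
      have hsa : ∑ i ∈ range (m' + 2), a i = ∑ i ∈ range (m' + 1), a (i + 1) + a 0 := by
        rw [Finset.sum_range_succ']
      have h00 := hu 0 0 (by omega) (by omega)
      have h01 := hu 0 1 (by omega) (by omega)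
      rw [hsplit, hsa]
      simp only [zero_add] at h00 h01 ⊢
      omega

/-- **Lee 2018, Appendix Lemma ("sumlemma"), subtraction-free form, 0-indexed.**  Let `p` be an integer, `n ≥ 1`,
`n + 2 ≤ m` and `2m + 1 ≤ p`; let `p ≥ a 0 ≥ ⋯ ≥ a (m-1) ≥ 1` with `∑_{i<m} a i ≥ n p + 1`, and let `u` satisfy
`min (a i + a j) (p + 1) ≤ u (i + j) + 1` for `i, j < m` (Lee: `μ_{i+j-1} ≥ min{λ_i + λ_j − 1, p}`).  Then
`∑_{k<2m-1} u k ≥ (2n + 1) p`.  Lee's induction (Cases 6–8 on `h`); in Case 8 with `n = 1` the inductive hypothesis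
is not available (the statement fails for `n = 0`), and we use the direct bound `u 2 ≥ a 0`, `u m ≥ a 1` instead. [cite: Lee2018, §6 Lemma (sum lemma), proof in Appendix] -/
theorem sumlemma :
    ∀ (n p m : ℕ) (a u : ℕ → ℕ), 1 ≤ n → n + 2 ≤ m → 2 * m + 1 ≤ p →
      (∀ i j, i ≤ j → j < m → a j ≤ a i) → (∀ i, i < m → 1 ≤ a i) → (∀ i, i < m → a i ≤ p) →
      n * p + 1 ≤ ∑ i ∈ range m, a i →
      (∀ i j, i < m → j < m → min (a i + a j) (p + 1) ≤ u (i + j) + 1) →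
      (2 * n + 1) * p ≤ ∑ k ∈ range (2 * m - 1), u k := by
  intro n
  induction n using Nat.strong_induction_on with
  | _ n ih =>
  intro p m a u hn hnm hmp hanti hpos hle hsum hu
  -- write `(2n+1)p = 2(np) + p` so that `n * p` is a single atom for `omega`
  have egoal : (2 * n + 1) * p = 2 * (n * p) + p := by ring
  by_cases h2 : p + 2 ≤ a 0 + a 1
  · -- Case `h ≥ 2`
    have hu0 : p ≤ u 0 := by
      have := hu 0 0 (by omega) (by omega)
      have ha01 : a 1 ≤ a 0 := hanti 0 1 (by omega) (by omega)
      rw [min_eq_right (by omega)] at this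
      simpa using this
    have hu1 : p ≤ u 1 := by
      have := hu 0 1 (by omega) (by omega)
      rw [min_eq_right (by omega)] at this
      simpa using this
    by_cases hn1 : n = 1
    · subst hn1
      -- direct argument: `u 2 ≥ a 0`, `u m ≥ a 1`
      have hu2 : a 0 ≤ u 2 := by
        have h02 := hu 0 2 (by omega) (by omega)
        have ha2 := hpos 2 (by omega)
        have ha0 := hle 0 (by omega)
        have : a 0 + 1 ≤ min (a 0 + a 2) (p + 1) := le_min (by omega) (by omega)
        simp only [zero_add] at h02
        omega
      have hum : a 1 ≤ u m := by
        have := hu 1 (m - 1) (by omega) (by omega)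
        have ham := hpos (m - 1) (by omega)
        have ha1 := hle 1 (by omega)
        have e : 1 + (m - 1) = m := by omega
        rw [e] at this
        have : a 1 + 1 ≤ min (a 1 + a (m - 1)) (p + 1) := le_min (by omega) (by omega)
        omega
      have hsub : ({0, 1, 2, m} : Finset ℕ) ⊆ range (2 * m - 1) := by
        intro k hk
        simp only [mem_insert, mem_singleton] at hk
        simp only [mem_range]
        omega
      have hle4 := Finset.sum_le_sum_of_subset (f := u) hsub
      have e4 : ∑ k ∈ ({0, 1, 2, m} : Finset ℕ), u k = u 0 + u 1 + u 2 + u m := by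
        rw [sum_insert (by simp; omega), sum_insert (by simp; omega), sum_insert (by simp; omega),
          sum_singleton]
        ring
      rw [e4] at hle4
      omega
    · -- `n ≥ 2`: induction hypothesis for the tail `(a 1, …, a (m-1))`
      have hsa : ∑ i ∈ range m, a i = ∑ i ∈ range (m - 1), a (i + 1) + a 0 := by
        have e : m = (m - 1) + 1 := by omega
        rw [e, Finset.sum_range_succ']
        simp
      have ha0 := hle 0 (by omega)
      have hpnp : p ≤ n * p := Nat.le_mul_of_pos_left p (by omega)
      have hih := ih (n - 1) (by omega) p (m - 1) (fun i => a (i + 1)) (fun k => u (k + 2)) (by omega)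
        (by omega) (by omega)
        (fun i j hij hj => hanti (i + 1) (j + 1) (by omega) (by omega))
        (fun i hi => hpos (i + 1) (by omega)) (fun i hi => hle (i + 1) (by omega))
        (by
          have e : (n - 1) * p = n * p - p := Nat.sub_one_mul n p
          rw [e]; omega)
        (fun i j hi hj => by
          have := hu (i + 1) (j + 1) (by omega) (by omega)
          rwa [show i + 1 + (j + 1) = i + j + 2 by ring] at this)
      have hsplit : ∑ k ∈ range (2 * m - 1), u k =
          (∑ k ∈ range (2 * (m - 1) - 1), u (k + 2) + u (0 + 1)) + u 0 := by
        have e : 2 * m - 1 = (2 * (m - 1) - 1) + 1 + 1 := by omega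
        rw [e, Finset.sum_range_succ', Finset.sum_range_succ']
      rw [hsplit]
      have e2 : (2 * (n - 1) + 1) * p = 2 * (n * p) - p := by
        rw [show 2 * (n - 1) + 1 = 2 * n - 1 by omega, Nat.sub_one_mul, Nat.mul_assoc]
      rw [e2] at hih
      simp only [zero_add] at hih ⊢
      omega
  · by_cases h1 : p + 2 ≤ 2 * a 0
    · -- Case `h = 1`
      have hu0 : p ≤ u 0 := by
        have := hu 0 0 (by omega) (by omega)
        rw [min_eq_right (by omega)] at this
        simpa using this
      -- all other pairs are below the cap
      have hu' : ∀ i j, i < m → j < m → 1 ≤ i + j → a i + a j ≤ u (i + j) + 1 := by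
        intro i j hi hj hij
        have := hu i j hi hj
        have hcap : a i + a j ≤ p + 1 := by
          rcases Nat.eq_zero_or_pos j with hj0 | hj0
          · subst hj0
            have := hanti 1 i (by omega) hi
            have := hanti 0 0 le_rfl (by omega)
            omega
          · have := hanti 1 j (by omega) hj
            have := hanti 0 i (Nat.zero_le i) hi
            omega
        rwa [min_eq_left hcap] at this
      by_cases hn1 : n = 1
      · subst hn1
        by_cases hm3 : m = 3
        · subst hm3
          have h01 := hu' 0 1 (by omega) (by omega) (by omega)
          have h02 := hu' 0 2 (by omega) (by omega) (by omega)
          have h12 := hu' 1 2 (by omega) (by omega) (by omega)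
          have h22 := hu' 2 2 (by omega) (by omega) (by omega)
          have ha2 := hpos 2 (by omega)
          simp only [Nat.reduceAdd, Nat.reduceMul, Nat.reduceSub, sum_range_succ, sum_range_zero,
            zero_add] at h01 h02 h12 h22 hsum ⊢
          omega
        · -- `m ≥ 4`
          obtain ⟨m'', rfl⟩ : ∃ m'', m = m'' + 4 := ⟨m - 4, by omega⟩
          have hsplit : ∑ k ∈ range (2 * (m'' + 4) - 1), u k =
              (∑ k ∈ range (m'' + 2), u (k + 1) + u 0) + ∑ j ∈ range (m'' + 4), u (m'' + 3 + j) := by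
            have e : 2 * (m'' + 4) - 1 = (m'' + 3) + (m'' + 4) := by omega
            rw [e, Finset.sum_range_add, Finset.sum_range_succ']
          have hA : ∀ k ∈ range (m'' + 2), a 0 ≤ u (k + 1) := by
            intro k hk
            simp only [mem_range] at hk
            have := hu' 0 (k + 1) (by omega) (by omega) (by omega)
            have := hpos (k + 1) (by omega)
            simp only [zero_add] at *
            omega
          have hB : ∀ j ∈ range (m'' + 4), a j ≤ u (m'' + 3 + j) := by
            intro j hj
            simp only [mem_range] at hj
            have := hu' j (m'' + 3) (by omega) (by omega) (by omega)
            have := hpos (m'' + 3) (by omega)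
            rw [show j + (m'' + 3) = m'' + 3 + j by ring] at *
            omega
          have hsA := Finset.sum_le_sum hA
          have hsB := Finset.sum_le_sum hB
          simp only [sum_const, card_range, smul_eq_mul] at hsA
          rw [hsplit]
          have key : 2 * a 0 ≤ (m'' + 2) * a 0 := Nat.mul_le_mul_right _ (by omega)
          omega
      · -- `n ≥ 2`: Lemma 6 for `a` and `u` with `u 0` replaced by `2 a 0`
        have ha0 := hle 0 (by omega)
        let u' : ℕ → ℕ := fun k => if k = 0 then 2 * a 0 else u k
        have hL := three_mul_sum_le_sum_add_three m a u' (by omega) hanti hpos (by omega)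
          (fun i j hi hj => by
            by_cases hij : i + j = 0
            · have hi0 : i = 0 := by omega
              have hj0 : j = 0 := by omega
              subst hi0 hj0
              simp [u']; omega
            · have := hu' i j hi hj (by omega)
              simp only [u', hij, if_false]
              exact this)
        have hsplit : ∀ v : ℕ → ℕ, ∑ k ∈ range (2 * m - 1), v k =
            ∑ k ∈ range (2 * m - 2), v (k + 1) + v 0 := by
          intro v
          have e : 2 * m - 1 = (2 * m - 2) + 1 := by omega
          rw [e, Finset.sum_range_succ']
        rw [hsplit u'] at hL
        rw [hsplit u]
        have hu'0 : u' 0 = 2 * a 0 := by simp [u']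
        have hu'k : ∑ k ∈ range (2 * m - 2), u' (k + 1) = ∑ k ∈ range (2 * m - 2), u (k + 1) :=
          Finset.sum_congr rfl fun k _ => by simp [u']
        rw [hu'0, hu'k] at hL
        have : 2 * p ≤ n * p := Nat.mul_le_mul_right p (by omega)
        omega
    · -- Case `h = 0`: every pair is below the cap; Lemma 6 directly
      have hu' : ∀ i j, i < m → j < m → a i + a j ≤ u (i + j) + 1 := by
        intro i j hi hj
        have := hu i j hi hj
        have hcap : a i + a j ≤ p + 1 := by
          have := hanti 0 i (Nat.zero_le i) hi
          have := hanti 0 j (Nat.zero_le j) hj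
          omega
        rwa [min_eq_left hcap] at this
      have ha0 : 2 ≤ a 0 := by
        by_contra hlt
        have hall : ∀ i ∈ range m, a i ≤ 1 := fun i hi => by
          have := hanti 0 i (Nat.zero_le i) (by simpa using hi); omega
        have := Finset.sum_le_sum hall
        simp only [sum_const, card_range, smul_eq_mul, mul_one] at this
        have : p ≤ n * p := Nat.le_mul_of_pos_left p (by omega)
        omega
      have hL := three_mul_sum_le_sum_add_three m a u (by omega) hanti hpos ha0 hu'
      have : p ≤ n * p := Nat.le_mul_of_pos_left p (by omega)
      omega



section Arithmetic

/-- The final arithmetic of Lee's Lemma 4 (with `P = p^{d-3}`): from the two averaging inequalities and the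
pencil count, `|S| ≥ m p^{d-1}`. [cite: Lee2018, §7 proof of Lemma 4] -/
theorem key_ineq (p P m X Y N : ℕ) (hp : 2 ≤ p) (hP : 1 ≤ P)
    (h1 : N * (p ^ 3 * P - 1) ≤ Y * (p ^ 2 * P - 1))
    (h2 : X * (p ^ 2 * P - 1) ≤ N * (p * P - 1))
    (h3 : (p + 1) * m * (p * P) ≤ Y + 1 + p * (X + 1)) :
    m * (p ^ 2 * P) ≤ Y + 1 := by
  have hpP : 1 ≤ p * P := Nat.le_trans hP (Nat.le_mul_of_pos_left P (by omega))
  have hp2P : 1 ≤ p ^ 2 * P := Nat.le_trans hpP (Nat.mul_le_mul_right P (by nlinarith))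
  have hp3P : 1 ≤ p ^ 3 * P := Nat.le_trans hpP (Nat.mul_le_mul_right P (by nlinarith))
  -- combine `h1` and `h2`: `X (p³P − 1) ≤ Y (pP − 1)`
  have h4 : X * (p ^ 3 * P - 1) ≤ Y * (p * P - 1) := by
    have hA : X * (p ^ 2 * P - 1) * (p ^ 3 * P - 1) ≤ N * (p * P - 1) * (p ^ 3 * P - 1) :=
      Nat.mul_le_mul_right _ h2
    have hB : N * (p ^ 3 * P - 1) * (p * P - 1) ≤ Y * (p ^ 2 * P - 1) * (p * P - 1) :=
      Nat.mul_le_mul_right _ h1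
    have hC : X * (p ^ 3 * P - 1) * (p ^ 2 * P - 1) ≤ Y * (p * P - 1) * (p ^ 2 * P - 1) := by
      calc X * (p ^ 3 * P - 1) * (p ^ 2 * P - 1) = X * (p ^ 2 * P - 1) * (p ^ 3 * P - 1) := by ring
        _ ≤ N * (p * P - 1) * (p ^ 3 * P - 1) := hA
        _ = N * (p ^ 3 * P - 1) * (p * P - 1) := by ring
        _ ≤ Y * (p ^ 2 * P - 1) * (p * P - 1) := hB
        _ = Y * (p * P - 1) * (p ^ 2 * P - 1) := by ring
    have hpos : 0 < p ^ 2 * P - 1 := by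
      have : 2 ≤ p ^ 2 * P := Nat.le_trans (by nlinarith) (Nat.le_mul_of_pos_right _ (by omega))
      omega
    exact Nat.le_of_mul_le_mul_right hC hpos
  by_contra hcon
  -- `Y + 2 ≤ m p² P`
  have hY : Y + 2 ≤ m * (p ^ 2 * P) := by omega
  -- from `h3`: `p (X + 1) ≥ m p P − p + 1 + p`, hence `X ≥ m P`
  have hX : m * P ≤ X := by
    by_contra hX
    have hX' : p * (X + 1) ≤ p * (m * P) := Nat.mul_le_mul_left p (by omega)
    nlinarith
  -- contradiction with `h4`
  zify [hpP, hp3P] at h4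
  have e1 : ((X : ℤ) - m * P) * ((p : ℤ) ^ 3 * P - 1) ≥ 0 := by
    apply mul_nonneg
    · have : ((m * P : ℕ) : ℤ) ≤ X := by exact_mod_cast hX
      push_cast at this; linarith
    · have : (1 : ℤ) ≤ (p : ℤ) ^ 3 * P := by exact_mod_cast hp3P
      linarith
  have e2 : ((m : ℤ) * (p ^ 2 * P) - Y - 2) * ((p : ℤ) * P - 1) ≥ 0 := by
    apply mul_nonneg
    · have : ((Y + 2 : ℕ) : ℤ) ≤ ((m * (p ^ 2 * P) : ℕ) : ℤ) := by exact_mod_cast hY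
      push_cast at this; linarith
    · have : (1 : ℤ) ≤ (p : ℤ) * P := by exact_mod_cast hpP
      linarith
  have e3 : (p : ℤ) * P ≥ 2 := by
    have : (2 : ℤ) ≤ p := by exact_mod_cast hp
    have : (1 : ℤ) ≤ P := by exact_mod_cast hP
    nlinarith
  have e4 : (m : ℤ) * P * ((p : ℤ) ^ 2 - 1) ≥ 0 := by
    apply mul_nonneg (by positivity)
    have : (2 : ℤ) ≤ p := by exact_mod_cast hp
    nlinarith
  nlinarith [e1, e2, e3, e4]

/-- The Galois connection of the natural-number ceiling `⌈x/d⌉ = (x + d - 1)/d`: `⌈x/d⌉ ≤ k ↔ x ≤ k d`. [folklore] -/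
private theorem ceilDiv_le_iff (x d k : ℕ) (hd : 0 < d) : (x + d - 1) / d ≤ k ↔ x ≤ k * d := by
  rw [← Nat.lt_add_one_iff, Nat.div_lt_iff_lt_mul hd, add_mul, one_mul]
  omega

/-- `⌈⌈r/a⌉/b⌉ = ⌈r/(ab)⌉` for natural-number ceilings `⌈x/d⌉ = (x + d - 1)/d`. [folklore] -/
private theorem ceilDiv_ceilDiv (r a b : ℕ) (ha : 0 < a) (hb : 0 < b) :
    ((r + a - 1) / a + b - 1) / b = (r + a * b - 1) / (a * b) := by
  have key : ∀ (x d : ℕ), 0 < d → ∀ k : ℕ, (x + d - 1) / d ≤ k ↔ x ≤ k * d :=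
    fun x d hd k => ceilDiv_le_iff x d k hd
  apply le_antisymm
  · rw [key _ _ hb]
    have h := (key r (a * b) (Nat.mul_pos ha hb) ((r + a * b - 1) / (a * b))).1 le_rfl
    rw [key _ _ ha]
    simpa [mul_comm, mul_assoc, mul_left_comm] using h
  · rw [key _ _ (Nat.mul_pos ha hb)]
    have h := (key ((r + a - 1) / a) b hb (((r + a - 1) / a + b - 1) / b)).1 le_rfl
    have h' := (key r a ha ((((r + a - 1) / a + b - 1) / b) * b)).1 h
    simpa [mul_comm, mul_assoc, mul_left_comm] using h'

end Arithmetic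

section LinAlg

variable {p : ℕ} [hp : Fact p.Prime]
variable {W : Type*} [AddCommGroup W] [Module (ZMod p) W]

/-- Fibres of a surjective additive homomorphism between finite groups all have size `|W| / |C|`. [folklore] -/
private theorem card_filter_eq_mul_card [Fintype W] {C : Type*} [AddCommGroup C] [Fintype C] [DecidableEq C]
    (φ : W →+ C) (hφ : Function.Surjective φ) (c : C) :
    #(univ.filter fun w => φ w = c) * Fintype.card C = Fintype.card W := by
  have heq : ∀ c' ∈ (univ : Finset C),
      #(univ.filter fun w => φ w = c') = #(univ.filter fun w => φ w = c) :=
    fun c' _ => AddMonoidHom.card_fiber_eq_of_mem_range φ (Set.mem_range.2 (hφ c')) (Set.mem_range.2 (hφ c))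
  have h := Finset.card_eq_sum_card_fiberwise (f := φ) (s := (univ : Finset W)) (t := (univ : Finset C))
    (fun _ _ => mem_coe.2 (mem_univ _))
  rw [Finset.sum_congr rfl heq, sum_const, smul_eq_mul, card_univ, card_univ] at h
  rw [h, mul_comm]

/-- A finite `ZMod p`-module has `p ^ finrank` elements. [folklore] -/
private theorem card_eq_pow_finrank' [Fintype W] : Fintype.card W = p ^ finrank (ZMod p) W := by
  rw [Module.card_eq_pow_finrank (K := ZMod p), ZMod.card]

/-- `|Dual W| = |W|`. [folklore] -/
private theorem card_dual [Fintype W] [Fintype (Module.Dual (ZMod p) W)] :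
    Fintype.card (Module.Dual (ZMod p) W) = Fintype.card W :=
  (Fintype.card_congr (Module.finBasis (ZMod p) W).toDualEquiv.toEquiv).symm

/-- For `x ≠ 0`, exactly `|W| / p` functionals vanish at `x`. [folklore] -/
private theorem card_dual_vanishing_mul [Fintype W] [Fintype (Module.Dual (ZMod p) W)] {x : W} (hx : x ≠ 0) :
    #(univ.filter fun g : Module.Dual (ZMod p) W => g x = 0) * p = Fintype.card W := by
  obtain ⟨f, hf⟩ := Module.Projective.exists_dual_eq_one (ZMod p) hx
  let ev : Module.Dual (ZMod p) W →+ ZMod p := (Module.Dual.eval (ZMod p) W x).toAddMonoidHom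
  have hev : Function.Surjective ev := fun c => ⟨c • f, by simp [ev, hf]⟩
  have h := card_filter_eq_mul_card ev hev 0
  rw [ZMod.card, card_dual] at h
  exact h

/-- The kernel of a nonzero functional has `|W| / p` elements. [folklore] -/
private theorem card_filter_apply_eq_zero_mul [Fintype W] {f : Module.Dual (ZMod p) W} (hf : f ≠ 0) :
    #(univ.filter fun x : W => f x = 0) * p = Fintype.card W := by
  have hsurj : Function.Surjective f := LinearMap.surjective_of_ne_zero hf
  have h := card_filter_eq_mul_card f.toAddMonoidHom hsurj 0
  rw [ZMod.card] at h
  exact h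

/-- A functional outside the line spanned by `f₁`, together with `f₁ ≠ 0`, is linearly independent of it. [folklore] -/
private theorem eq_zero_of_lin_comb {f₁ g : Module.Dual (ZMod p) W} (hf₁ : f₁ ≠ 0)
    (hg : g ∉ Submodule.span (ZMod p) {f₁}) {a b : ZMod p} (h : a • f₁ + b • g = 0) : a = 0 ∧ b = 0 := by
  by_cases hb : b = 0
  · subst hb
    rw [zero_smul, add_zero] at h
    rcases smul_eq_zero.1 h with ha | hf
    · exact ⟨ha, rfl⟩
    · exact absurd hf hf₁
  · exfalso
    apply hg
    have hbg : b • g = -(a • f₁) := eq_neg_of_add_eq_zero_right h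
    apply (Submodule.smul_mem_iff _ hb).1
    rw [hbg]
    exact Submodule.neg_mem _ (Submodule.smul_mem _ a (Submodule.mem_span_singleton_self f₁))

/-- In `𝔽_p²`, a nonzero linear equation `a u + b v = 0` in the unknowns `(a, b)` has exactly `p` solutions. [folklore] -/
private theorem card_filter_lin_eq (u v : ZMod p) (huv : (u, v) ≠ 0) :
    #((univ : Finset (ZMod p × ZMod p)).filter fun ab => ab.1 * u + ab.2 * v = 0) = p := by
  by_cases hv : v = 0
  · subst hv
    have hu : u ≠ 0 := by rintro rfl; exact huv rfl
    have : ((univ : Finset (ZMod p × ZMod p)).filter fun ab => ab.1 * u + ab.2 * 0 = 0) =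
        (univ : Finset (ZMod p)).image fun b => ((0 : ZMod p), b) := by
      ext ⟨a, b⟩
      simp only [mem_filter, mem_univ, true_and, mul_zero, add_zero, mem_image, Prod.mk.injEq]
      constructor
      · intro h
        exact ⟨b, (mul_eq_zero.1 h).resolve_right hu |>.symm, rfl⟩
      · rintro ⟨b', rfl, rfl⟩; simp
    rw [this, card_image_of_injective _ (fun b b' h => (Prod.mk.inj h).2), card_univ, ZMod.card]
  · have : ((univ : Finset (ZMod p × ZMod p)).filter fun ab => ab.1 * u + ab.2 * v = 0) =
        (univ : Finset (ZMod p)).image fun a => (a, -(a * u) * v⁻¹) := by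
      ext ⟨a, b⟩
      simp only [mem_filter, mem_univ, true_and, mem_image, Prod.mk.injEq]
      constructor
      · intro h
        refine ⟨a, rfl, ?_⟩
        have hb : b * v = -(a * u) := eq_neg_of_add_eq_zero_right h
        rw [← hb, mul_assoc, mul_inv_cancel₀ hv, mul_one]
      · rintro ⟨a', rfl, rfl⟩
        rw [mul_assoc, inv_mul_cancel₀ hv, mul_one, add_neg_cancel]
    rw [this, card_image_of_injective _ (fun a a' h => (Prod.mk.inj h).1), card_univ, ZMod.card]

/-- **Averaging step (one level of Lee's expectation argument).**  `|W| = p^{k+1}`, `k ≥ 1`, `f₁` a functional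
(possibly `0`), `s` = the number of functionals on the line through `f₁`.  For `T = {x ∈ S ∖ {0} : f₁ x = 0}`
there is a functional `g` off that line with `#{x ∈ T : g x = 0} · (p^{k+1} − s) ≤ #T · (p^k − s)`. [cite: Lee2018, §7 proof of Lemma 4 (expectation step)] -/
theorem exists_dual_sparse [Fintype W] [DecidableEq W] [Fintype (Module.Dual (ZMod p) W)] (k : ℕ) (hk : 1 ≤ k)
    (hW : Fintype.card W = p ^ (k + 1)) (f₁ : Module.Dual (ZMod p) W) (S : Finset W) (s : ℕ)
    (hs : Nat.card (Submodule.span (ZMod p) {f₁}) = s) :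
    ∃ g : Module.Dual (ZMod p) W, g ∉ Submodule.span (ZMod p) {f₁} ∧
      #(((S.erase 0).filter fun x => f₁ x = 0).filter fun x => g x = 0) * (p ^ (k + 1) - s) ≤
        #((S.erase 0).filter fun x => f₁ x = 0) * (p ^ k - s) := by
  classical
  have hp2 : 2 ≤ p := hp.out.two_le
  set T : Finset W := (S.erase 0).filter fun x => f₁ x = 0 with hT
  set L : Finset (Module.Dual (ZMod p) W) := univ.filter fun g => g ∈ Submodule.span (ZMod p) {f₁} with hL
  set D : Finset (Module.Dual (ZMod p) W) := univ.filter fun g => g ∉ Submodule.span (ZMod p) {f₁} with hD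
  have hcardDual : Fintype.card (Module.Dual (ZMod p) W) = p ^ (k + 1) := by rw [card_dual, hW]
  have hLs : #L = s := by
    rw [← hs, Nat.card_eq_fintype_card, Fintype.card_subtype]
  -- the line through `f₁` has at most `p` points
  have hsp : s ≤ p := by
    rw [← hLs]
    have hsub : L ⊆ (univ : Finset (ZMod p)).image fun c => c • f₁ := by
      intro g hg
      rw [hL, mem_filter, Submodule.mem_span_singleton] at hg
      obtain ⟨c, rfl⟩ := hg.2
      exact mem_image.2 ⟨c, mem_univ _, rfl⟩
    calc #L ≤ #((univ : Finset (ZMod p)).image fun c => c • f₁) := card_le_card hsub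
      _ ≤ #(univ : Finset (ZMod p)) := card_image_le
      _ = p := by rw [card_univ, ZMod.card]
  have hDcard : #D = p ^ (k + 1) - s := by
    have : D = univ \ L := by
      ext g; simp [hD, hL]
    rw [this, card_sdiff_of_subset (subset_univ L), card_univ, hcardDual, hLs]
  -- for `x ∈ T`: exactly `p^k − s` functionals of `D` vanish at `x`
  have hTx : ∀ x ∈ T, #(D.filter fun g => g x = 0) = p ^ k - s := by
    intro x hx
    rw [hT, mem_filter, mem_erase] at hx
    have hx0 : x ≠ 0 := hx.1.1
    have hfx : f₁ x = 0 := hx.2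
    have hsub : L ⊆ univ.filter fun g : Module.Dual (ZMod p) W => g x = 0 := by
      intro g hg
      rw [hL, mem_filter, Submodule.mem_span_singleton] at hg
      obtain ⟨c, rfl⟩ := hg.2
      simp [hfx]
    have heq : (D.filter fun g => g x = 0) = (univ.filter fun g : Module.Dual (ZMod p) W => g x = 0) \ L := by
      ext g
      simp only [hD, hL, mem_filter, mem_univ, true_and, mem_sdiff]
      tauto
    have hzero : #(univ.filter fun g : Module.Dual (ZMod p) W => g x = 0) = p ^ k := by
      have h := card_dual_vanishing_mul (p := p) hx0
      rw [hW, pow_succ] at h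
      exact Nat.eq_of_mul_eq_mul_right hp.out.pos h
    rw [heq, card_sdiff_of_subset hsub, hzero, hLs]
  -- double counting
  have hdc : ∑ g ∈ D, #(T.filter fun x => g x = 0) = ∑ x ∈ T, #(D.filter fun g => g x = 0) := by
    have h := Finset.sum_card_bipartiteAbove_eq_sum_card_bipartiteBelow
      (fun (g : Module.Dual (ZMod p) W) (x : W) => g x = 0) (s := D) (t := T)
    simpa [Finset.bipartiteAbove, Finset.bipartiteBelow] using h
  rw [Finset.sum_congr rfl hTx, sum_const, smul_eq_mul] at hdc
  -- `D` is nonempty since `s ≤ p < p^{k+1}`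
  have hDne : D.Nonempty := by
    rw [← card_pos, hDcard]
    have : p < p ^ (k + 1) := by
      calc p = p ^ 1 := (pow_one p).symm
        _ < p ^ (k + 1) := Nat.pow_lt_pow_right (by omega) (by omega)
    omega
  have hsum : ∑ g ∈ D, #(T.filter fun x => g x = 0) * #D ≤ ∑ g ∈ D, #T * (p ^ k - s) := by
    rw [← sum_mul, hdc, sum_const, smul_eq_mul]
    exact le_of_eq (by ring)
  obtain ⟨g, hgD, hg⟩ := Finset.exists_le_of_sum_le hDne hsum
  refine ⟨g, (mem_filter.1 hgD).2, ?_⟩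
  rw [hDcard] at hg
  exact hg

/-- The line through `0` is a point. [folklore] -/
private theorem natCard_span_zero : Nat.card (Submodule.span (ZMod p) {(0 : Module.Dual (ZMod p) W)}) = 1 := by
  have : Submodule.span (ZMod p) {(0 : Module.Dual (ZMod p) W)} = ⊥ := by simp
  rw [this]
  exact Nat.card_unique

/-- The line through a nonzero functional has `p` points. [folklore] -/
private theorem natCard_span_of_ne_zero {f₁ : Module.Dual (ZMod p) W} (hf₁ : f₁ ≠ 0) :
    Nat.card (Submodule.span (ZMod p) {f₁}) = p := by
  rw [← Nat.card_congr (LinearEquiv.toSpanNonzeroSingleton (ZMod p) (Module.Dual (ZMod p) W) f₁ hf₁).toEquiv,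
    Nat.card_zmod]

/-- **Lee 2018, Lemma 4 (hyperplane intersection lemma), cardinality form.**  Let `|W| = p^{e+3}` (dimension
`d = e + 3 ≥ 3`), `S ⊆ W` with `0 ∈ S`, and suppose every hyperplane `ker f` (`f ≠ 0`) contains at least
`m p^{d-2}` points of `S`.  Then `|S| ≥ m p^{d-1}`.  (Lee finds a sparse `(d−2)`-subspace by a uniformly random
choice; we take two successive averaging steps over hyperplanes, which yields the same expectation bound, and
then his count over the `p + 1` hyperplanes containing that subspace.) [cite: Lee2018, Lemma 4] -/
theorem le_card_of_forall_dual [Fintype W] [DecidableEq W] (e m : ℕ) (hW : Fintype.card W = p ^ (e + 3)) (S : Finset W)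
    (h0 : (0 : W) ∈ S)
    (hS : ∀ f : Module.Dual (ZMod p) W, f ≠ 0 → m * p ^ (e + 1) ≤ #(S.filter fun x => f x = 0)) :
    m * p ^ (e + 2) ≤ #S := by
  classical
  haveI : Fintype (Module.Dual (ZMod p) W) := by
    haveI : Finite (Module.Dual (ZMod p) W) := Module.finite_of_finite (ZMod p)
    exact Fintype.ofFinite _
  have hp2 : 2 ≤ p := hp.out.two_le
  -- first averaging step (`f₁ = 0`)
  obtain ⟨f₁, hf₁, h1⟩ := exists_dual_sparse (e + 2) (by omega) hW 0 S 1 natCard_span_zero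
  have hf₁0 : f₁ ≠ 0 := by
    intro h; apply hf₁; rw [h]; exact Submodule.zero_mem _
  have hT0 : ((S.erase 0).filter fun x => (0 : Module.Dual (ZMod p) W) x = 0) = S.erase 0 :=
    Finset.filter_true_of_mem fun x _ => by simp
  rw [hT0] at h1
  -- second averaging step
  obtain ⟨g, hg, h2⟩ := exists_dual_sparse (e + 2) (by omega) hW f₁ S p (natCard_span_of_ne_zero hf₁0)
  -- names for the counts
  set Y := #(S.erase 0) with hY
  set N := #((S.erase 0).filter fun x => f₁ x = 0) with hN
  set X := #(((S.erase 0).filter fun x => f₁ x = 0).filter fun x => g x = 0) with hX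
  have hSY : #S = Y + 1 := (card_erase_add_one h0).symm
  -- the pencil of hyperplanes through `ker f₁ ∩ ker g`
  set PP : Finset (ZMod p × ZMod p) := univ.erase 0 with hPPdef
  have hPP : #PP = p ^ 2 - 1 := by
    rw [hPPdef, card_erase_of_mem (mem_univ _), card_univ, Fintype.card_prod, ZMod.card, sq]
  have hψ : ∀ ab ∈ PP, m * p ^ (e + 1) ≤ #(S.filter fun x => ab.1 * f₁ x + ab.2 * g x = 0) := by
    intro ab hab
    have hab0 : ab ≠ 0 := (mem_erase.1 hab).1
    have hne : ab.1 • f₁ + ab.2 • g ≠ 0 := by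
      intro h
      obtain ⟨ha, hb⟩ := eq_zero_of_lin_comb hf₁0 hg h
      exact hab0 (Prod.ext ha hb)
    have h := hS _ hne
    have heq : (S.filter fun x => (ab.1 • f₁ + ab.2 • g) x = 0) =
        S.filter fun x => ab.1 * f₁ x + ab.2 * g x = 0 := by
      congr 1
    rw [heq] at h
    exact h
  -- double count over the pencil
  have hdc : ∑ ab ∈ PP, #(S.filter fun x => ab.1 * f₁ x + ab.2 * g x = 0)
      = ∑ x ∈ S, #(PP.filter fun ab => ab.1 * f₁ x + ab.2 * g x = 0) := by
    have h := Finset.sum_card_bipartiteAbove_eq_sum_card_bipartiteBelow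
      (fun (ab : ZMod p × ZMod p) (x : W) => ab.1 * f₁ x + ab.2 * g x = 0) (s := PP) (t := S)
    simpa [Finset.bipartiteAbove, Finset.bipartiteBelow] using h
  have hfib : ∀ x ∈ S, #(PP.filter fun ab => ab.1 * f₁ x + ab.2 * g x = 0)
      = if f₁ x = 0 ∧ g x = 0 then p ^ 2 - 1 else p - 1 := by
    intro x _
    split_ifs with hxx
    · rw [Finset.filter_true_of_mem (fun ab _ => by simp [hxx.1, hxx.2]), hPP]
    · have hne : (f₁ x, g x) ≠ 0 := fun h => hxx (Prod.mk_eq_zero.1 h)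
      rw [hPPdef, Finset.filter_erase, card_erase_of_mem (by simp), card_filter_lin_eq _ _ hne]
  rw [Finset.sum_congr rfl hfib, Finset.sum_ite, sum_const, sum_const, smul_eq_mul, smul_eq_mul] at hdc
  have hlow : #PP * (m * p ^ (e + 1)) ≤ ∑ ab ∈ PP, #(S.filter fun x => ab.1 * f₁ x + ab.2 * g x = 0) := by
    have h := Finset.card_nsmul_le_sum PP _ _ hψ
    rwa [smul_eq_mul] at h
  -- relate the counts of the two filters of `S` to `X` and `Y`
  have hboth : #(S.filter fun x => f₁ x = 0 ∧ g x = 0) = X + 1 := by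
    have h0' : (0 : W) ∈ S.filter fun x => f₁ x = 0 ∧ g x = 0 := by simp [h0]
    rw [hX, Finset.filter_filter, Finset.filter_erase, ← card_erase_add_one h0']
  set Nc := #(S.filter fun x => ¬(f₁ x = 0 ∧ g x = 0)) with hNc
  have hsplit : X + 1 + Nc = Y + 1 := by
    rw [← hboth, hNc, ← hSY, Finset.card_filter_add_card_filter_not]
  rw [hboth] at hdc
  rw [hdc, hPP] at hlow
  -- `hlow : (p² − 1) (m p^{e+1}) ≤ (X + 1)(p² − 1) + Nc (p − 1)`; divide by `p − 1`
  have h3 : (p + 1) * m * (p * p ^ e) ≤ Y + 1 + p * (X + 1) := by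
    have hp1 : 1 ≤ p := by omega
    have hp21 : 1 ≤ p ^ 2 := Nat.one_le_pow _ _ (by omega)
    zify [hp1, hp21] at hlow
    have hfac : ((p : ℤ) ^ 2 - 1) = ((p : ℤ) - 1) * (p + 1) := by ring
    have hpos : (0 : ℤ) < (p : ℤ) - 1 := by
      have : (2 : ℤ) ≤ p := by exact_mod_cast hp2
      linarith
    have hNc' : (Nc : ℤ) = Y - X := by
      have := congrArg (fun n : ℕ => (n : ℤ)) hsplit
      push_cast at this
      linarith
    have key : ((p : ℤ) - 1) * ((p + 1) * m * (p * p ^ e)) ≤ ((p : ℤ) - 1) * (Y + 1 + p * (X + 1)) := by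
      have e1 : ((p : ℤ) - 1) * ((p + 1) * m * (p * p ^ e)) = ((p : ℤ) ^ 2 - 1) * (m * p ^ (e + 1)) := by
        ring
      have e2 : ((p : ℤ) - 1) * (Y + 1 + p * (X + 1)) = (X + 1) * ((p : ℤ) ^ 2 - 1) + (Y - X) * (p - 1) := by
        ring
      rw [e1, e2, ← hNc']
      exact hlow
    have := le_of_mul_le_mul_left key hpos
    exact_mod_cast this
  -- reshape `h1`, `h2` and conclude with the arithmetic lemma
  have hP : 1 ≤ p ^ e := Nat.one_le_pow _ _ (by omega)
  have h1' : N * (p ^ 3 * p ^ e - 1) ≤ Y * (p ^ 2 * p ^ e - 1) := by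
    have e3 : p ^ (e + 2 + 1) = p ^ 3 * p ^ e := by ring
    have e2 : p ^ (e + 2) = p ^ 2 * p ^ e := by ring
    rw [e3, e2] at h1
    exact h1
  have h2' : X * (p ^ 2 * p ^ e - 1) ≤ N * (p * p ^ e - 1) := by
    have e3 : p ^ (e + 2 + 1) - p = p * (p ^ 2 * p ^ e - 1) := by
      rw [Nat.mul_sub_one]; ring_nf
    have e2 : p ^ (e + 2) - p = p * (p * p ^ e - 1) := by
      rw [Nat.mul_sub_one]; ring_nf
    rw [e3, e2] at h2
    have h2'' : p * (X * (p ^ 2 * p ^ e - 1)) ≤ p * (N * (p * p ^ e - 1)) := by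
      calc p * (X * (p ^ 2 * p ^ e - 1)) = X * (p * (p ^ 2 * p ^ e - 1)) := by ring
        _ ≤ N * (p * (p * p ^ e - 1)) := h2
        _ = p * (N * (p * p ^ e - 1)) := by ring
    exact Nat.le_of_mul_le_mul_left h2'' (by omega)
  have hfinal := key_ineq p (p ^ e) m X Y N hp2 hP h1' h2' h3
  rw [hSY]
  calc m * p ^ (e + 2) = m * (p ^ 2 * p ^ e) := by ring
    _ ≤ Y + 1 := hfinal

/-- **Lee 2018, Lemma 2 (independence of dimension) — the counting step.**  If `|W| = p^{e+1}` and `D ⊆ W`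
contains `0` and has at most `p^e` elements, some nonzero `v ∈ W` lies on no line through a point of `D`
(i.e. the line `𝔽_p v` meets `D` only in `0`). [cite: Lee2018, Lemma 2 (proof)] -/
theorem exists_smul_ne [Fintype W] [DecidableEq W] (e : ℕ) (hW : Fintype.card W = p ^ (e + 1)) (D : Finset W) (h0 : (0 : W) ∈ D)
    (hD : #D ≤ p ^ e) : ∃ v : W, v ≠ 0 ∧ ∀ (c : ZMod p) (x : W), x ∈ D → c • x ≠ v := by
  classical
  have hp2 : 2 ≤ p := hp.out.two_le
  let I : Finset W :=
    insert 0 ((((univ : Finset (ZMod p)).erase 0) ×ˢ D.erase 0).image fun cx => cx.1 • cx.2)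
  have hI : #I < #(univ : Finset W) := by
    have hDe : #(D.erase 0) + 1 = #D := card_erase_add_one h0
    have hpe : 1 ≤ p ^ e := Nat.one_le_pow _ _ (by omega)
    calc #I ≤ #((((univ : Finset (ZMod p)).erase 0) ×ˢ D.erase 0).image fun cx => cx.1 • cx.2) + 1 :=
          card_insert_le _ _
      _ ≤ #(((univ : Finset (ZMod p)).erase 0) ×ˢ D.erase 0) + 1 := by
          gcongr; exact card_image_le
      _ = (p - 1) * (#D - 1) + 1 := by
          rw [card_product, card_erase_of_mem (mem_univ _), card_univ, ZMod.card, card_erase_of_mem h0]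
      _ ≤ (p - 1) * (p ^ e - 1) + 1 := by gcongr
      _ < p ^ (e + 1) := by
          have hp1 : 1 ≤ p := by omega
          zify [hp1, hpe]
          rw [pow_succ]
          nlinarith
      _ = #(univ : Finset W) := by rw [card_univ, hW]
  obtain ⟨v, -, hv⟩ := Finset.exists_mem_notMem_of_card_lt_card hI
  refine ⟨v, ?_, ?_⟩
  · rintro rfl; exact hv (mem_insert_self _ _)
  · intro c x hx hcx
    apply hv
    by_cases hc : c = 0
    · subst hc; rw [zero_smul] at hcx; rw [← hcx]; exact mem_insert_self _ _
    by_cases hx0 : x = 0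
    · subst hx0; rw [smul_zero] at hcx; rw [← hcx]; exact mem_insert_self _ _
    refine mem_insert_of_mem (mem_image.2 ⟨(c, x), ?_, hcx⟩)
    exact mem_product.2 ⟨mem_erase.2 ⟨hc, mem_univ _⟩, mem_erase.2 ⟨hx0, hx⟩⟩

/-- **Lee 2018, Lemma 2 — the projection step.**  If the line `𝔽_p v` meets `A − A` only in `0`, the quotient
map `W → W / 𝔽_p v` is injective on `A`. [cite: Lee2018, Lemma 2 (proof)] -/
theorem injOn_mkQ [DecidableEq W] (A : Finset W) {v : W} (hv : ∀ (c : ZMod p) (x : W), x ∈ A - A → c • x ≠ v) :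
    Set.InjOn (Submodule.span (ZMod p) {v}).mkQ (A : Set W) := by
  intro a ha b hb hab
  rw [Submodule.mkQ_apply, Submodule.mkQ_apply, Submodule.Quotient.eq] at hab
  obtain ⟨c, hc⟩ := Submodule.mem_span_singleton.1 hab
  by_cases hc0 : c = 0
  · rw [hc0, zero_smul] at hc
    exact (sub_eq_zero.1 hc.symm)
  · exfalso
    apply hv c⁻¹ (a - b) (sub_mem_sub (mem_coe.1 ha) (mem_coe.1 hb))
    rw [← hc, smul_smul, inv_mul_cancel₀ hc0, one_smul]

/-- `|W / 𝔽_p v| = |W| / p` for `v ≠ 0`. [folklore] -/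
private theorem card_quotient_span [Fintype W] (e : ℕ) (hW : Fintype.card W = p ^ (e + 1)) {v : W} (hv : v ≠ 0)
    [Fintype (W ⧸ Submodule.span (ZMod p) {v})] :
    Fintype.card (W ⧸ Submodule.span (ZMod p) {v}) = p ^ e := by
  have h := Submodule.card_eq_card_quotient_mul_card (Submodule.span (ZMod p) {v})
  rw [Nat.card_eq_fintype_card, hW, ← Nat.card_congr (LinearEquiv.toSpanNonzeroSingleton (ZMod p) W v hv).toEquiv,
    Nat.card_zmod, Nat.card_eq_fintype_card, pow_succ, mul_comm] at h
  exact (Nat.eq_of_mul_eq_mul_left hp.out.pos h).symm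

end LinAlg


section TwoDim

variable {p : ℕ} [hp : Fact p.Prime]

/-! ### The case `p < r ≤ p²` in `𝔽_p²` (Lee 2018, §6, Lemma 3) -/

/-- Cauchy–Davenport for a difference set in `ℤ/p`. [folklore] -/
private theorem min_le_card_sub_zmod {s t : Finset (ZMod p)} (hs : s.Nonempty) (ht : t.Nonempty) :
    min p (#s + #t - 1) ≤ #(s - t) := by
  rw [sub_eq_add_neg, ← card_neg t]
  exact ZMod.cauchy_davenport hp.out hs ht.neg

/-- The arithmetic of Lee's Case 2 (with `n = a + 1`, `p = 2a + 2b + 3`): the pair-count inequality forces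
`s ≥ (p + 1)/2`. [cite: Lee2018, §6 proof of Lemma 3, Case 2] -/
theorem case_two_arith (a b s R : ℕ) (hR : s * (a + 2) + R = (a + 1) * (2 * a + 2 * b + 3) + 1)
    (hineq : ((a + 1) * (2 * a + 2 * b + 3) + 1) * ((a + 1) * (2 * a + 2 * b + 3)) ≤
      (2 * a + 2 * b + 4) * (s * ((a + 2) * (a + 1)) + a * R)) : a + b + 2 ≤ s := by
  by_contra hlt
  have hs : s ≤ a + b + 1 := by omega
  have hR' := congrArg (fun t => t * (a * (2 * a + 2 * b + 4))) hR
  have h1 : ((a + 1) * (2 * a + 2 * b + 3) + 1) * (a + 2 * b + 3) ≤ (2 * a + 2 * b + 4) * (a + 2) * s := by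
    nlinarith [hineq, hR']
  have h2 : (2 * a + 2 * b + 4) * (a + 2) * s ≤ (2 * a + 2 * b + 4) * (a + 2) * (a + b + 1) :=
    Nat.mul_le_mul_left _ hs
  nlinarith [h1, h2, Nat.zero_le (a * b), Nat.zero_le (a * b * b), Nat.zero_le (a * a * b), Nat.zero_le (a * a),
    Nat.zero_le a, Nat.zero_le b]

/-- The column of `A ⊆ 𝔽_p²` above `x`: `{y : (x, y) ∈ A}`. [folklore] -/
def col (A : Finset (ZMod p × ZMod p)) (x : ZMod p) : Finset (ZMod p) :=
  (A.filter fun a => a.1 = x).image Prod.snd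

omit hp in
/-- Membership in a column. [folklore] -/
private theorem mem_col {A : Finset (ZMod p × ZMod p)} {x y : ZMod p} : y ∈ col A x ↔ (x, y) ∈ A := by
  constructor
  · intro h
    obtain ⟨a, ha, rfl⟩ := mem_image.1 h
    obtain ⟨haA, hax⟩ := mem_filter.1 ha
    rwa [← hax]
  · intro h
    exact mem_image.2 ⟨(x, y), mem_filter.2 ⟨h, rfl⟩, rfl⟩

omit hp in
/-- A column has as many points of `A` as the vertical line it sits on. [folklore] -/
private theorem card_col (A : Finset (ZMod p × ZMod p)) (x : ZMod p) : #(col A x) = #(A.filter fun a => a.1 = x) := by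
  apply card_image_of_injOn
  intro a ha b hb hab
  rw [mem_coe, mem_filter] at ha hb
  exact Prod.ext (ha.2.trans hb.2.symm) hab

/-- The columns partition `A`. [folklore] -/
private theorem sum_card_col (A : Finset (ZMod p × ZMod p)) : ∑ x, #(col A x) = #A := by
  rw [card_eq_sum_card_fiberwise (f := Prod.fst) (s := A) (t := (univ : Finset (ZMod p)))
    (fun _ _ => mem_coe.2 (mem_univ _))]
  exact Finset.sum_congr rfl fun x _ => card_col A x

/-- Differences of two columns of `A` lie in a column of `A − A`. [folklore] -/
private theorem col_sub_col_subset (A : Finset (ZMod p × ZMod p)) (x₁ x₂ : ZMod p) :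
    col A x₁ - col A x₂ ⊆ col (A - A) (x₁ - x₂) := by
  intro y hy
  obtain ⟨y₁, hy₁, y₂, hy₂, rfl⟩ := mem_sub.1 hy
  rw [mem_col] at hy₁ hy₂ ⊢
  have : ((x₁, y₁) : ZMod p × ZMod p) - (x₂, y₂) = (x₁ - x₂, y₁ - y₂) := rfl
  rw [← this]
  exact sub_mem_sub hy₁ hy₂

/-- Cauchy–Davenport applied to two columns (Lee: "we are applying the Cauchy–Davenport Theorem only to the
second coordinates"). [cite: Lee2018, §6 proof of Lemma 3] -/
theorem min_le_card_col_sub {A : Finset (ZMod p × ZMod p)} {x₁ x₂ : ZMod p} (h₁ : (col A x₁).Nonempty)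
    (h₂ : (col A x₂).Nonempty) : min p (#(col A x₁) + #(col A x₂) - 1) ≤ #(col (A - A) (x₁ - x₂)) :=
  (min_le_card_sub_zmod h₁ h₂).trans (card_le_card (col_sub_col_subset A x₁ x₂))

/-- A column has at most `p` points. [folklore] -/
private theorem card_col_le (A : Finset (ZMod p × ZMod p)) (x : ZMod p) : #(col A x) ≤ p :=
  (card_le_univ _).trans (by rw [ZMod.card])

/-- Layer-cake: `∑_{k<K} #{x : k < c x} = ∑_x c x` when all `c x ≤ K`. [folklore] -/
private theorem sum_card_filter_lt (c : ZMod p → ℕ) (K : ℕ) (hc : ∀ x, c x ≤ K) :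
    ∑ k ∈ range K, #(univ.filter fun x => k < c x) = ∑ x, c x := by
  have h := Finset.sum_card_bipartiteAbove_eq_sum_card_bipartiteBelow (fun (k : ℕ) (x : ZMod p) => k < c x)
    (s := range K) (t := (univ : Finset (ZMod p)))
  simp only [Finset.bipartiteAbove, Finset.bipartiteBelow] at h
  rw [h]
  refine Finset.sum_congr rfl fun x _ => ?_
  have : ((range K).filter fun k => k < c x) = range (c x) := by
    ext k
    simp only [mem_filter, mem_range]
    constructor
    · exact fun h => h.2
    · exact fun h => ⟨lt_of_lt_of_le h (hc x), h⟩
  rw [this, card_range]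

/-- The number of ordered pairs of distinct points of `A` in a common column is `∑_x (c_x² − c_x)`. [cite: Lee2018, §6 proof of Lemma 3] -/
theorem card_vertical_pairs (A : Finset (ZMod p × ZMod p)) :
    #(A.offDiag.filter fun ab => ab.1.1 = ab.2.1) = ∑ x, (#(col A x) * #(col A x) - #(col A x)) := by
  rw [card_eq_sum_card_fiberwise (f := fun ab : (ZMod p × ZMod p) × (ZMod p × ZMod p) => ab.1.1)
    (s := A.offDiag.filter fun ab => ab.1.1 = ab.2.1) (t := (univ : Finset (ZMod p)))
    (fun _ _ => mem_coe.2 (mem_univ _))]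
  refine Finset.sum_congr rfl fun x _ => ?_
  have : ((A.offDiag.filter fun ab => ab.1.1 = ab.2.1).filter fun ab => ab.1.1 = x) =
      (A.filter fun a => a.1 = x).offDiag := by
    ext ⟨a, b⟩
    simp only [mem_filter, mem_offDiag]
    constructor
    · rintro ⟨⟨⟨ha, hb, hab⟩, h1⟩, h2⟩
      exact ⟨⟨ha, h2⟩, ⟨hb, h1 ▸ h2⟩, hab⟩
    · rintro ⟨⟨ha, h2⟩, ⟨hb, h3⟩, hab⟩
      exact ⟨⟨⟨ha, hb, hab⟩, h2.trans h3.symm⟩, h2⟩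
  rw [this, offDiag_card, ← card_col]

/-- **Case analysis of Lee's Lemma 3, after the choice of a good direction.**  `p` odd, `|A| = np + 1` with
`1 ≤ n ≤ (p−1)/2`, and the vertical direction carries at least the average number of pairs:
`|A|(|A| − 1) ≤ (p + 1) · #{(a, b) ∈ A², a ≠ b, a₁ = b₁}`.  Then `|A − A| ≥ (2n + 1)p`. [cite: Lee2018, Lemma 3 (proof, Cases 1–3)] -/
theorem two_dim_vertical (hodd : Odd p) {n : ℕ} (hn : 1 ≤ n) (hnp : 2 * n + 1 ≤ p)
    (A : Finset (ZMod p × ZMod p)) (hA : #A = n * p + 1)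
    (hQ : #A * (#A - 1) ≤ (p + 1) * #(A.offDiag.filter fun ab => ab.1.1 = ab.2.1)) :
    (2 * n + 1) * p ≤ #(A - A) := by
  classical
  have hp2 : 2 ≤ p := hp.out.two_le
  have hsumc : ∑ x, #(col A x) = n * p + 1 := by rw [sum_card_col, hA]
  have hsumc' : ∑ x, #(col (A - A) x) = #(A - A) := sum_card_col _
  have hcardF : #(univ : Finset (ZMod p)) = p := by rw [card_univ, ZMod.card]
  -- a fattest column
  obtain ⟨x₀, -, hx₀⟩ : ∃ x₀ ∈ (univ : Finset (ZMod p)), ∀ x ∈ (univ : Finset (ZMod p)),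
      #(col A x) ≤ #(col A x₀) := exists_max_image univ (fun x => #(col A x)) univ_nonempty
  set m := #(col A x₀) with hmdef
  have hcle : ∀ x, #(col A x) ≤ m := fun x => hx₀ x (mem_univ _)
  have hm : n + 1 ≤ m := by
    by_contra hlt
    have hall : ∀ x ∈ (univ : Finset (ZMod p)), #(col A x) ≤ n := fun x _ => by
      have := hcle x; omega
    have := Finset.sum_le_sum hall
    rw [hsumc, sum_const, smul_eq_mul, hcardF] at this
    rw [mul_comm] at this
    omega
  have hnA : A.Nonempty := by rw [← card_pos, hA]; omega
  have h0AA : (0 : ZMod p × ZMod p) ∈ A - A := by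
    obtain ⟨a, ha⟩ := hnA
    simpa using sub_mem_sub ha ha
  have hcolne : ∀ x, 1 ≤ #(col A x) → (col A x).Nonempty := fun x hx => by
    rw [← card_pos]; exact hx
  by_cases hcase1 : p + 1 ≤ 2 * m
  · /- Case 1: a column with at least `(p+1)/2` points: the vertical line lies in `A − A`, and every other
    direction contributes `2n` nonzero points on its line through `0`. -/
    have hcol0 : col (A - A) 0 = univ := by
      apply eq_univ_of_card
      rw [ZMod.card]
      apply le_antisymm (card_col_le _ _)
      have h := min_le_card_col_sub (A := A) (hcolne x₀ (by omega)) (hcolne x₀ (by omega))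
      rw [sub_self, ← hmdef] at h
      have : min p (m + m - 1) = p := min_eq_left (by omega)
      omega
    -- for every slope `s`, `2n` points `(d, s d)`, `d ≠ 0`, of `A − A`
    have hslope : ∀ s : ZMod p, ∃ E : Finset (ZMod p × ZMod p), E ⊆ A - A ∧ 2 * n ≤ #E ∧
        ∀ z ∈ E, z.1 ≠ 0 ∧ z.2 = s * z.1 := by
      intro s
      -- a line `y = s x + t` with at least `n + 1` points of `A`
      have hfib : ∃ t : ZMod p, n + 1 ≤ #(A.filter fun a => a.2 - s * a.1 = t) := by
        by_contra hno
        have hno' : ∀ t : ZMod p, #(A.filter fun a => a.2 - s * a.1 = t) ≤ n := fun t => by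
          by_contra h; exact hno ⟨t, by omega⟩
        have hsum := card_eq_sum_card_fiberwise (f := fun a : ZMod p × ZMod p => a.2 - s * a.1) (s := A)
          (t := (univ : Finset (ZMod p))) (fun _ _ => mem_coe.2 (mem_univ _))
        have : ∑ t ∈ (univ : Finset (ZMod p)), #(A.filter fun a => a.2 - s * a.1 = t) ≤
            ∑ _t ∈ (univ : Finset (ZMod p)), n := Finset.sum_le_sum fun t _ => hno' t
        rw [← hsum, sum_const, smul_eq_mul, hcardF, hA, mul_comm] at this
        omega
      obtain ⟨t, ht⟩ := hfib
      set L := A.filter fun a => a.2 - s * a.1 = t with hL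
      set X : Finset (ZMod p) := L.image Prod.fst with hX
      have hmemL : ∀ a ∈ L, a ∈ A ∧ a.2 = t + s * a.1 := fun a ha => by
        rw [hL, mem_filter] at ha
        exact ⟨ha.1, by rw [← ha.2]; ring⟩
      have hXcard : #X = #L := by
        apply card_image_of_injOn
        intro a ha b hb hab
        obtain ⟨-, ha2⟩ := hmemL a (mem_coe.1 ha)
        obtain ⟨-, hb2⟩ := hmemL b (mem_coe.1 hb)
        refine Prod.ext hab ?_
        rw [ha2, hb2, hab]
      have hXne : X.Nonempty := by rw [← card_pos, hXcard]; omega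
      have hXX : 2 * n + 1 ≤ #(X - X) := by
        have h := min_le_card_sub_zmod hXne hXne
        have : 2 * n + 1 ≤ min p (#X + #X - 1) := le_min hnp (by rw [hXcard]; omega)
        omega
      refine ⟨((X - X).erase 0).image fun d => (d, s * d), ?_, ?_, ?_⟩
      · intro z hz
        obtain ⟨d, hd, rfl⟩ := mem_image.1 hz
        obtain ⟨-, hd⟩ := mem_erase.1 hd
        obtain ⟨x₁, hx₁, x₂, hx₂, rfl⟩ := mem_sub.1 hd
        rw [hX] at hx₁ hx₂
        obtain ⟨a, ha, rfl⟩ := mem_image.1 hx₁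
        obtain ⟨b, hb, rfl⟩ := mem_image.1 hx₂
        obtain ⟨haA, ha2⟩ := hmemL a ha
        obtain ⟨hbA, hb2⟩ := hmemL b hb
        have hab : a - b = (a.1 - b.1, s * (a.1 - b.1)) := by
          ext
          · rfl
          · show a.2 - b.2 = s * (a.1 - b.1)
            rw [ha2, hb2]; ring
        rw [← hab]
        exact sub_mem_sub haA hbA
      · have : #(((X - X).erase 0).image fun d => (d, s * d)) = #((X - X).erase 0) :=
          card_image_of_injective _ fun d d' h => (Prod.mk.inj h).1
        rw [this]
        have := pred_card_le_card_erase (s := X - X) (a := 0)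
        omega
      · intro z hz
        obtain ⟨d, hd, rfl⟩ := mem_image.1 hz
        exact ⟨(mem_erase.1 hd).1, rfl⟩
    choose E hEsub hEcard hEmem using hslope
    -- the punctured vertical line
    set E₀ : Finset (ZMod p × ZMod p) := ((univ : Finset (ZMod p)).erase 0).image fun y => ((0 : ZMod p), y)
      with hE₀
    have hE₀sub : E₀ ⊆ A - A := by
      intro z hz
      obtain ⟨y, -, rfl⟩ := mem_image.1 hz
      rw [← mem_col, hcol0]
      exact mem_univ _
    have hE₀card : #E₀ = p - 1 := by
      rw [hE₀, card_image_of_injective _ (fun y y' h => (Prod.mk.inj h).2), card_erase_of_mem (mem_univ _),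
        hcardF]
    have hE₀mem : ∀ z ∈ E₀, z.1 = 0 ∧ z.2 ≠ 0 := by
      intro z hz
      obtain ⟨y, hy, rfl⟩ := mem_image.1 hz
      exact ⟨rfl, (mem_erase.1 hy).1⟩
    -- all the pieces, indexed by `Option (ZMod p)`
    let P : Option (ZMod p) → Finset (ZMod p × ZMod p) := fun o => o.elim E₀ E
    have hPnone : P none = E₀ := rfl
    have hPsome : ∀ s, P (some s) = E s := fun _ => rfl
    have hPsub : ∀ o, P o ⊆ A - A := by
      rintro (_ | s)
      · exact hE₀sub
      · exact hEsub s
    have hP0 : ∀ o, (0 : ZMod p × ZMod p) ∉ P o := by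
      rintro (_ | s) h
      · exact (hE₀mem 0 h).2 rfl
      · exact (hEmem s 0 h).1 rfl
    have hPdisj : ((univ : Finset (Option (ZMod p))) : Set (Option (ZMod p))).PairwiseDisjoint P := by
      rintro o₁ - o₂ - hne
      rw [Function.onFun, disjoint_left]
      intro z hz₁ hz₂
      apply hne
      rcases o₁ with _ | s₁ <;> rcases o₂ with _ | s₂
      · rfl
      · exact absurd (hE₀mem z hz₁).1 (hEmem s₂ z hz₂).1
      · exact absurd (hE₀mem z hz₂).1 (hEmem s₁ z hz₁).1
      · obtain ⟨h1, h2⟩ := hEmem s₁ z hz₁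
        obtain ⟨-, h2'⟩ := hEmem s₂ z hz₂
        rw [h2] at h2'
        rw [mul_left_injective₀ h1 h2']
    have hsub : insert 0 ((univ : Finset (Option (ZMod p))).biUnion P) ⊆ A - A := by
      intro z hz
      rcases mem_insert.1 hz with rfl | hz
      · exact h0AA
      · obtain ⟨o, -, ho⟩ := mem_biUnion.1 hz
        exact hPsub o ho
    have h0not : (0 : ZMod p × ZMod p) ∉ (univ : Finset (Option (ZMod p))).biUnion P := by
      intro h
      obtain ⟨o, -, ho⟩ := mem_biUnion.1 h
      exact hP0 o ho
    have hcard : #(insert 0 ((univ : Finset (Option (ZMod p))).biUnion P)) =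
        1 + ((p - 1) + ∑ s : ZMod p, #(E s)) := by
      rw [card_insert_of_notMem h0not, card_biUnion hPdisj, Fintype.sum_option, hPnone, hE₀card]
      simp only [hPsome]
      ring
    have hsumE : p * (2 * n) ≤ ∑ s : ZMod p, #(E s) := by
      have h := Finset.card_nsmul_le_sum (univ : Finset (ZMod p)) (fun s => #(E s)) (2 * n) fun s _ => hEcard s
      rwa [smul_eq_mul, hcardF] at h
    calc (2 * n + 1) * p = 1 + ((p - 1) + p * (2 * n)) := by
          zify [show 1 ≤ p by omega]; ring
      _ ≤ 1 + ((p - 1) + ∑ s : ZMod p, #(E s)) := by gcongr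
      _ = #(insert 0 ((univ : Finset (Option (ZMod p))).biUnion P)) := hcard.symm
      _ ≤ #(A - A) := card_le_card hsub
  · -- every column has at most `(p − 1)/2` points
    have hm2 : 2 * m + 1 ≤ p := by
      obtain ⟨k, hk⟩ := hodd
      omega
    by_cases hcase2 : m = n + 1
    · /- Case 2: the columns of size exactly `n + 1` form a set `S` with `|S| ≥ (p+1)/2`, so `S − S = 𝔽_p`
      and every column of `A − A` has at least `2n + 1` points. -/
      set S : Finset (ZMod p) := univ.filter fun x => #(col A x) = n + 1 with hSdef
      set s := #S with hsdef
      have hcS : ∀ x ∈ S, #(col A x) = n + 1 := fun x hx => by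
        rw [hSdef, mem_filter] at hx; exact hx.2
      have hcnotS : ∀ x ∈ univ.filter (fun x => ¬ #(col A x) = n + 1), #(col A x) ≤ n := fun x hx => by
        rw [mem_filter] at hx
        have := hcle x
        omega
      have hsplit := (Finset.sum_filter_add_sum_filter_not univ (fun x => #(col A x) = n + 1)
        (fun x => #(col A x) * #(col A x) - #(col A x))).symm
      have hS1 : ∑ x ∈ S, (#(col A x) * #(col A x) - #(col A x)) = s * ((n + 1) * n) := by
        calc ∑ x ∈ S, (#(col A x) * #(col A x) - #(col A x)) = ∑ x ∈ S, ((n + 1) * n) :=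
              Finset.sum_congr rfl fun x hx => by rw [hcS x hx, ← Nat.mul_sub_one, Nat.add_sub_cancel]
          _ = s * ((n + 1) * n) := by rw [sum_const, smul_eq_mul]
      set R := ∑ x ∈ univ.filter (fun x => ¬ #(col A x) = n + 1), #(col A x) with hRdef
      have hS2 : ∑ x ∈ univ.filter (fun x => ¬ #(col A x) = n + 1), (#(col A x) * #(col A x) - #(col A x))
          ≤ (n - 1) * R := by
        rw [hRdef, Finset.mul_sum]
        refine Finset.sum_le_sum fun x hx => ?_
        have hcx := hcnotS x hx
        rw [← Nat.mul_sub_one, mul_comm]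
        exact Nat.mul_le_mul_right _ (by omega)
      have hR : s * (n + 1) + R = n * p + 1 := by
        rw [← hsumc, ← Finset.sum_filter_add_sum_filter_not univ (fun x => #(col A x) = n + 1)
          (fun x => #(col A x))]
        congr 1
        rw [Finset.sum_congr rfl hcS, sum_const, smul_eq_mul]
      have hineq : (n * p + 1) * (n * p) ≤ (p + 1) * (s * ((n + 1) * n) + (n - 1) * R) := by
        have hA1 : #A * (#A - 1) = (n * p + 1) * (n * p) := by rw [hA, Nat.add_sub_cancel]
        calc (n * p + 1) * (n * p) = #A * (#A - 1) := hA1.symm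
          _ ≤ (p + 1) * #(A.offDiag.filter fun ab => ab.1.1 = ab.2.1) := hQ
          _ = (p + 1) * ∑ x, (#(col A x) * #(col A x) - #(col A x)) := by rw [card_vertical_pairs]
          _ ≤ (p + 1) * (s * ((n + 1) * n) + (n - 1) * R) := by
              apply Nat.mul_le_mul_left
              rw [hsplit, hS1]
              exact Nat.add_le_add_left hS2 _
      -- hence `2 s ≥ p + 1`
      have hs2 : p + 1 ≤ 2 * s := by
        obtain ⟨a, rfl⟩ : ∃ a, n = a + 1 := ⟨n - 1, by omega⟩
        obtain ⟨k, hk⟩ := hodd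
        obtain ⟨b, hb⟩ : ∃ b, p = 2 * a + 2 * b + 3 := ⟨k - a - 1, by omega⟩
        have hR' : s * (a + 2) + R = (a + 1) * (2 * a + 2 * b + 3) + 1 := by
          rw [← hb]; linarith
        have hineq' : ((a + 1) * (2 * a + 2 * b + 3) + 1) * ((a + 1) * (2 * a + 2 * b + 3)) ≤
            (2 * a + 2 * b + 4) * (s * ((a + 2) * (a + 1)) + a * R) := by
          rw [hb, Nat.add_sub_cancel] at hineq
          nlinarith [hineq]
        have := case_two_arith a b s R hR' hineq'
        omega
      have hSne : S.Nonempty := by rw [← card_pos]; omega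
      have hSS : S - S = univ := by
        apply eq_univ_of_card
        apply le_antisymm (card_le_univ _)
        have h := min_le_card_sub_zmod hSne hSne
        have : min p (#S + #S - 1) = p := min_eq_left (by omega)
        rw [ZMod.card]
        omega
      have hcol' : ∀ x, 2 * n + 1 ≤ #(col (A - A) x) := by
        intro x
        have hx : x ∈ S - S := by rw [hSS]; exact mem_univ _
        obtain ⟨y, hy, z, hz, rfl⟩ := mem_sub.1 hx
        have hcy := hcS y hy
        have hcz := hcS z hz
        have h := min_le_card_col_sub (A := A) (hcolne y (by omega)) (hcolne z (by omega))
        have : min p (#(col A y) + #(col A z) - 1) = 2 * n + 1 := by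
          rw [hcy, hcz, min_eq_right] <;> omega
        omega
      calc (2 * n + 1) * p = p * (2 * n + 1) := mul_comm _ _
        _ ≤ ∑ x, #(col (A - A) x) := by
            have h := Finset.card_nsmul_le_sum (univ : Finset (ZMod p)) (fun x => #(col (A - A) x))
              (2 * n + 1) fun x _ => hcol' x
            rwa [smul_eq_mul, hcardF] at h
        _ = #(A - A) := hsumc'
    · /- Case 3: `n + 2 ≤ m ≤ (p − 1)/2` — the distribution sequences `a k = #{x : c x > k}` of `A` and
      `u k = #{x : c' x > k}` of `A − A` satisfy the hypotheses of the appendix lemma. -/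
      have hm3 : n + 2 ≤ m := by omega
      let a : ℕ → ℕ := fun k => #(univ.filter fun x => k < #(col A x))
      let u : ℕ → ℕ := fun k => #(univ.filter fun x => k < #(col (A - A) x))
      have hanti : ∀ i j, i ≤ j → j < m → a j ≤ a i := fun i j hij _ =>
        card_le_card fun x hx => by
          simp only [mem_filter, mem_univ, true_and] at hx ⊢; omega
      have hpos : ∀ i, i < m → 1 ≤ a i := fun i hi =>
        card_pos.2 ⟨x₀, mem_filter.2 ⟨mem_univ _, lt_of_lt_of_eq hi hmdef⟩⟩
      have hle : ∀ i, i < m → a i ≤ p := fun i _ => (card_le_univ _).trans (by rw [ZMod.card])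
      have hsum : n * p + 1 ≤ ∑ i ∈ range m, a i := by
        show n * p + 1 ≤ ∑ i ∈ range m, #(univ.filter fun x => i < #(col A x))
        rw [sum_card_filter_lt (fun x => #(col A x)) m hcle, hsumc]
      have hu : ∀ i j, i < m → j < m → min (a i + a j) (p + 1) ≤ u (i + j) + 1 := by
        intro i j hi hj
        have hΛi : (univ.filter fun x => i < #(col A x)).Nonempty := card_pos.1 (hpos i hi)
        have hΛj : (univ.filter fun x => j < #(col A x)).Nonempty := card_pos.1 (hpos j hj)
        have hsub : (univ.filter fun x => i < #(col A x)) - (univ.filter fun x => j < #(col A x)) ⊆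
            univ.filter fun x => i + j < #(col (A - A) x) := by
          intro x hx
          obtain ⟨y, hy, z, hz, rfl⟩ := mem_sub.1 hx
          simp only [mem_filter, mem_univ, true_and] at hy hz ⊢
          have h := min_le_card_col_sub (A := A) (hcolne y (by omega)) (hcolne z (by omega))
          have : i + j + 1 ≤ min p (#(col A y) + #(col A z) - 1) := le_min (by omega) (by omega)
          omega
        have h := min_le_card_sub_zmod hΛi hΛj
        have h2 := card_le_card hsub
        show min (#(univ.filter fun x => i < #(col A x)) + #(univ.filter fun x => j < #(col A x))) (p + 1) ≤
          #(univ.filter fun x => i + j < #(col (A - A) x)) + 1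
        omega
      have hSL := sumlemma n p m a u hn hm3 hm2 hanti hpos hle hsum hu
      have hmp : 2 * m - 1 ≤ p := by omega
      have hrange : range (2 * m - 1) ⊆ range p := range_subset_range.2 hmp
      calc (2 * n + 1) * p ≤ ∑ k ∈ range (2 * m - 1), u k := hSL
        _ ≤ ∑ k ∈ range p, u k := Finset.sum_le_sum_of_subset hrange
        _ = ∑ x, #(col (A - A) x) := sum_card_filter_lt (fun x => #(col (A - A) x)) p (fun x => card_col_le _ _)
        _ = #(A - A) := hsumc'

/-! #### Directions of `𝔽_p²` and the choice of a good one -/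

/-- The functional constant on the lines of direction `o`: `none` = vertical lines (`x` constant),
`some s` = lines of slope `s` (`y − s x` constant). [folklore] -/
def dirφ (o : Option (ZMod p)) (a : ZMod p × ZMod p) : ZMod p :=
  match o with
  | none => a.1
  | some s => a.2 - s * a.1

/-- `dirφ o` is additive. [folklore] -/
private theorem dirφ_sub (o : Option (ZMod p)) (a b : ZMod p × ZMod p) : dirφ o (a - b) = dirφ o a - dirφ o b := by
  cases o with
  | none => rfl
  | some s => simp only [dirφ, Prod.fst_sub, Prod.snd_sub]; ring

/-- A nonzero vector lies on exactly one line through the origin. [folklore] -/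
private theorem card_filter_dirφ_eq_zero {g : ZMod p × ZMod p} (hg : g ≠ 0) :
    #((univ : Finset (Option (ZMod p))).filter fun o => dirφ o g = 0) = 1 := by
  rw [card_eq_one]
  by_cases h1 : g.1 = 0
  · have h2 : g.2 ≠ 0 := fun h2 => hg (Prod.ext h1 h2)
    refine ⟨none, ?_⟩
    ext o
    cases o with
    | none => simp [dirφ, h1]
    | some s => simp [dirφ, h1, h2]
  · refine ⟨some (g.2 * g.1⁻¹), ?_⟩
    ext o
    cases o with
    | none => simp [dirφ, h1]
    | some s =>
      simp only [dirφ, mem_filter, mem_univ, true_and, mem_singleton, Option.some.injEq]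
      constructor
      · intro h
        rw [sub_eq_zero] at h
        rw [h, mul_assoc, mul_inv_cancel₀ h1, mul_one]
      · rintro rfl
        rw [mul_assoc, inv_mul_cancel₀ h1, mul_one, sub_self]

/-- Counting the ordered pairs of distinct points of `A` by the direction they span: every pair is counted
exactly once (Lee's `∑_ℓ C(|A ∩ ℓ|, 2) = C(|A|, 2)`, in ordered form). [cite: Lee2018, §6 proof of Lemma 3 (line counting)] -/
theorem sum_card_pairs_dir (A : Finset (ZMod p × ZMod p)) :
    ∑ o : Option (ZMod p), #(A.offDiag.filter fun ab => dirφ o ab.1 = dirφ o ab.2) = #A * #A - #A := by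
  have h := Finset.sum_card_bipartiteAbove_eq_sum_card_bipartiteBelow
    (fun (o : Option (ZMod p)) (ab : (ZMod p × ZMod p) × (ZMod p × ZMod p)) => dirφ o ab.1 = dirφ o ab.2)
    (s := (univ : Finset (Option (ZMod p)))) (t := A.offDiag)
  simp only [Finset.bipartiteAbove, Finset.bipartiteBelow] at h
  rw [h, ← offDiag_card, Finset.card_eq_sum_ones A.offDiag]
  refine Finset.sum_congr rfl fun ab hab => ?_
  have hne : ab.1 - ab.2 ≠ 0 := sub_ne_zero.2 (mem_offDiag.1 hab).2.2
  rw [← card_filter_dirφ_eq_zero hne]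
  congr 1
  ext o
  simp only [mem_filter, mem_univ, true_and, dirφ_sub, sub_eq_zero]

/-- Some direction carries at least the average number of pairs. [cite: Lee2018, §6 proof of Lemma 3] -/
theorem exists_good_dir (A : Finset (ZMod p × ZMod p)) : ∃ o : Option (ZMod p),
    #A * (#A - 1) ≤ (p + 1) * #(A.offDiag.filter fun ab => dirφ o ab.1 = dirφ o ab.2) := by
  have hcard : #(univ : Finset (Option (ZMod p))) = p + 1 := by
    rw [card_univ, Fintype.card_option, ZMod.card]
  have hsum : ∑ _o : Option (ZMod p), #A * (#A - 1) ≤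
      ∑ o : Option (ZMod p), (p + 1) * #(A.offDiag.filter fun ab => dirφ o ab.1 = dirφ o ab.2) := by
    rw [sum_const, smul_eq_mul, hcard, ← mul_sum, sum_card_pairs_dir, Nat.mul_sub_one]
  obtain ⟨o, -, ho⟩ := exists_le_of_sum_le univ_nonempty hsum
  exact ⟨o, ho⟩

/-- The linear change of coordinates making direction `o` vertical: `(x, y) ↦ (y − s x, x)` for slope `s`. [folklore] -/
def dirT (o : Option (ZMod p)) : (ZMod p × ZMod p) ≃+ (ZMod p × ZMod p) :=
  match o with
  | none => AddEquiv.refl _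
  | some s =>
    { toFun := fun a => (a.2 - s * a.1, a.1)
      invFun := fun b => (b.2, b.1 + s * b.2)
      left_inv := fun a => by ext <;> simp
      right_inv := fun b => by ext <;> simp
      map_add' := fun a b => Prod.ext (by simp only [Prod.fst_add, Prod.snd_add]; ring) rfl }

/-- The first coordinate after the change of coordinates is the direction functional. [folklore] -/
private theorem dirT_fst (o : Option (ZMod p)) (a : ZMod p × ZMod p) : (dirT o a).1 = dirφ o a := by
  cases o <;> rfl

/-- Images under an additive equivalence commute with difference sets. [folklore] -/
private theorem image_sub_addEquiv {G H : Type*} [AddCommGroup G] [AddCommGroup H] [DecidableEq G]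
    [DecidableEq H] (e : G ≃+ H) (A B : Finset G) : (A - B).image e = A.image e - B.image e :=
  image_image₂_distrib (map_sub e)

/-- After the change of coordinates `dirT o`, pairs in a common column are the pairs of direction `o`. [folklore] -/
private theorem card_vertical_pairs_image (o : Option (ZMod p)) (A : Finset (ZMod p × ZMod p)) :
    #((A.image (dirT o)).offDiag.filter fun ab => ab.1.1 = ab.2.1) =
      #(A.offDiag.filter fun ab => dirφ o ab.1 = dirφ o ab.2) := by
  symm
  apply Finset.card_bij (fun ab _ => ((dirT o) ab.1, (dirT o) ab.2))
  · intro ab hab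
    rw [mem_filter, mem_offDiag] at hab ⊢
    obtain ⟨⟨h1, h2, hne⟩, heq⟩ := hab
    refine ⟨⟨mem_image_of_mem _ h1, mem_image_of_mem _ h2, fun h => hne ((dirT o).injective h)⟩, ?_⟩
    rw [dirT_fst, dirT_fst]
    exact heq
  · intro ab _ ab' _ h
    obtain ⟨h1, h2⟩ := Prod.mk.inj h
    exact Prod.ext ((dirT o).injective h1) ((dirT o).injective h2)
  · intro cd hcd
    rw [mem_filter, mem_offDiag] at hcd
    obtain ⟨⟨h1, h2, hne⟩, heq⟩ := hcd
    obtain ⟨a, ha, hac⟩ := mem_image.1 h1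
    obtain ⟨b, hb, hbd⟩ := mem_image.1 h2
    refine ⟨(a, b), ?_, Prod.ext (by simp [hac]) (by simp [hbd])⟩
    rw [mem_filter, mem_offDiag]
    refine ⟨⟨ha, hb, fun h => hne ?_⟩, ?_⟩
    · rw [← hac, ← hbd]
      exact congrArg (dirT o) h
    · rw [← hac, ← hbd, dirT_fst, dirT_fst] at heq
      exact heq

/-- The prime `2`: every `A ⊆ 𝔽₂²` with at least three points has `A − A = 𝔽₂²`. [cite: Lee2018, §6 proof of Lemma 3 (p = 2 by enumeration)] -/
theorem two_dim_two : ∀ A : Finset (ZMod 2 × ZMod 2), 2 < #A → 4 ≤ #(A - A) := by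
  decide

/-- **Lee 2018, Lemma 3 (the case `d = 2`, `p < r ≤ p²`).**  For `A ⊆ 𝔽_p²` with `p < |A| ≤ p²`:
`|A − A| ≥ p · min{2⌈|A|/p⌉ − 1, p}`. [cite: Lee2018, Lemma 3] -/
theorem two_dim (A : Finset (ZMod p × ZMod p)) (hpA : p < #A) :
    p * min (2 * ((#A + p - 1) / p) - 1) p ≤ #(A - A) := by
  classical
  have hp2 : 2 ≤ p := hp.out.two_le
  rcases hp.out.eq_two_or_odd' with hp2' | hodd
  · subst hp2'
    calc 2 * min (2 * ((#A + 2 - 1) / 2) - 1) 2 ≤ 2 * 2 := Nat.mul_le_mul_left _ (min_le_right _ _)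
      _ ≤ #(A - A) := two_dim_two A hpA
  · set q := (#A + p - 1) / p with hq
    have hqp : q * p ≤ #A + p - 1 := (Nat.le_div_iff_mul_le (by omega)).1 le_rfl
    have hq2 : 2 ≤ q := by
      rw [hq, Nat.le_div_iff_mul_le (by omega)]; omega
    -- choose `n` with `min (2q − 1) p = 2n + 1` and `np + 1 ≤ |A|`
    obtain ⟨n, hn1, hnp, hnA, htarget⟩ : ∃ n, 1 ≤ n ∧ 2 * n + 1 ≤ p ∧ n * p + 1 ≤ #A ∧
        min (2 * q - 1) p = 2 * n + 1 := by
      by_cases hsmall : 2 * q - 1 ≤ p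
      · refine ⟨q - 1, by omega, by omega, ?_, by rw [min_eq_left hsmall]; omega⟩
        rw [Nat.sub_one_mul]; omega
      · obtain ⟨k, hk⟩ := hodd
        have hkq : k + 1 ≤ q - 1 := by omega
        have := Nat.mul_le_mul_right p hkq
        refine ⟨k, by omega, by omega, ?_, by rw [min_eq_right (by omega)]; omega⟩
        rw [Nat.sub_one_mul] at this; rw [Nat.add_one_mul] at this; omega
    obtain ⟨A₀, hA₀A, hA₀⟩ := exists_subset_card_eq hnA
    obtain ⟨o, ho⟩ := exists_good_dir A₀
    have hA₁card : #(A₀.image (dirT o)) = n * p + 1 := by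
      rw [card_image_of_injective _ (dirT o).injective, hA₀]
    have hQ₁ : #(A₀.image (dirT o)) * (#(A₀.image (dirT o)) - 1) ≤
        (p + 1) * #((A₀.image (dirT o)).offDiag.filter fun ab => ab.1.1 = ab.2.1) := by
      rw [card_vertical_pairs_image, card_image_of_injective _ (dirT o).injective]; exact ho
    have h := two_dim_vertical hodd hn1 hnp (A₀.image (dirT o)) hA₁card hQ₁
    rw [← image_sub_addEquiv, card_image_of_injective _ (dirT o).injective] at h
    calc p * min (2 * q - 1) p = (2 * n + 1) * p := by rw [htarget, mul_comm]
      _ ≤ #(A₀ - A₀) := h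
      _ ≤ #(A - A) := card_le_card (sub_subset_sub hA₀A hA₀A)

end TwoDim

section Main

variable {p : ℕ} [hp : Fact p.Prime]

/-! ### Assembly: Lee's Main Theorem -/

/-- Lee's bound `p^t · min{2⌈r/p^t⌉ − 1, p}` for the minimum of `|A − A|` over `r`-sets, `p^t < r ≤ p^{t+1}`
(natural-number ceiling `⌈r/q⌉ = (r + q − 1)/q`). [cite: Lee2018, Thm (main)] -/
def leeBound (p t r : ℕ) : ℕ := p ^ t * min (2 * ((r + p ^ t - 1) / p ^ t) - 1) p

/-- Unfolding of `leeBound`. [cite: Lee2018, Thm (main)] -/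
theorem leeBound_def (p t r : ℕ) : leeBound p t r = p ^ t * min (2 * ((r + p ^ t - 1) / p ^ t) - 1) p := rfl

omit hp in
/-- `leeBound p t r ≤ p^{t+1}`. [cite: Lee2018, Thm (main)] -/
theorem leeBound_le_pow (t r : ℕ) : leeBound p t r ≤ p ^ (t + 1) := by
  rw [leeBound_def, pow_succ]
  exact Nat.mul_le_mul_left _ (min_le_right _ _)

/-- Images under an injective additive map commute with difference sets. [folklore] -/
private theorem image_sub_of_addHom {G H F : Type*} [AddCommGroup G] [AddCommGroup H] [DecidableEq G] [DecidableEq H]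
    [FunLike F G H] [AddMonoidHomClass F G H] (f : F) (A B : Finset G) :
    (A - B).image f = A.image f - B.image f :=
  image_image₂_distrib (map_sub f)

/-- An injective additive map preserves `|A − A|`. [folklore] -/
private theorem card_sub_image_of_injective {G H F : Type*} [AddCommGroup G] [AddCommGroup H] [DecidableEq G]
    [DecidableEq H] [FunLike F G H] [AddMonoidHomClass F G H] (f : F) (hf : Function.Injective f)
    (A : Finset G) : #(A.image f - A.image f) = #(A - A) := by
  rw [← image_sub_of_addHom, card_image_of_injective _ hf]

/-- **The case `t = 0`** (`|V| = p`, i.e. `V ≅ ℤ/p`): Cauchy–Davenport. [cite: Lee2018, §6 proof of Lemma 3 (r ≤ p: Cauchy–Davenport)] -/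
theorem one_dim {V : Type*} [AddCommGroup V] [Module (ZMod p) V] [Fintype V] [DecidableEq V]
    (hV : Fintype.card V = p) (A : Finset V) (hA : A.Nonempty) : min p (2 * #A - 1) ≤ #(A - A) := by
  classical
  have hfr : finrank (ZMod p) V = finrank (ZMod p) (ZMod p) := by
    rw [Module.finrank_self]
    have h := card_eq_pow_finrank' (p := p) (W := V)
    rw [hV] at h
    exact (Nat.pow_right_injective hp.out.two_le (by simpa using h : p ^ 1 = p ^ finrank (ZMod p) V)).symm
  let e : V ≃ₗ[ZMod p] ZMod p := LinearEquiv.ofFinrankEq V (ZMod p) hfr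
  have h := min_le_card_sub_zmod (p := p) (hA.image e) (hA.image e)
  rw [card_image_of_injective _ e.injective, card_sub_image_of_injective e e.injective] at h
  rwa [two_mul]

/-- **The case `t = 1`** (`|V| = p²`, i.e. `V ≅ 𝔽_p²`): Lemma 3, transported. [cite: Lee2018, Lemma 3] -/
theorem two_dim' {V : Type*} [AddCommGroup V] [Module (ZMod p) V] [Fintype V] [DecidableEq V]
    (hV : Fintype.card V = p ^ 2) (A : Finset V) (hA : p < #A) :
    p * min (2 * ((#A + p - 1) / p) - 1) p ≤ #(A - A) := by
  classical
  have hfr : finrank (ZMod p) V = finrank (ZMod p) (ZMod p × ZMod p) := by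
    rw [Module.finrank_prod, Module.finrank_self]
    have h := card_eq_pow_finrank' (p := p) (W := V)
    rw [hV] at h
    exact (Nat.pow_right_injective hp.out.two_le h).symm
  let e : V ≃ₗ[ZMod p] (ZMod p × ZMod p) := LinearEquiv.ofFinrankEq V _ hfr
  have h := two_dim (p := p) (A.image e) (by rwa [card_image_of_injective _ e.injective])
  rwa [card_image_of_injective _ e.injective, card_sub_image_of_injective e e.injective] at h

/-- The kernel of a nonzero functional on `V` with `|V| = p^{k+1}` has `p^k` elements. [folklore] -/
private theorem card_ker {V : Type*} [AddCommGroup V] [Module (ZMod p) V] [Fintype V] [DecidableEq V] {k : ℕ}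
    (hV : Fintype.card V = p ^ (k + 1)) {f : Module.Dual (ZMod p) V} (hf : f ≠ 0)
    [Fintype (LinearMap.ker f)] : Fintype.card (LinearMap.ker f) = p ^ k := by
  classical
  have h := card_filter_apply_eq_zero_mul (p := p) hf
  rw [hV, pow_succ] at h
  have h' := Nat.eq_of_mul_eq_mul_right hp.out.pos h
  rw [← h']
  rw [← Fintype.card_subtype]
  apply Fintype.card_congr
  exact Equiv.subtypeEquivRight fun x => LinearMap.mem_ker

/-- **Core of the induction (Lee, §7): spaces of dimension exactly `t + 1`.** [cite: Lee2018, §7 proof of Thm (main)] -/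
theorem core_dim : ∀ (t : ℕ) {V : Type*} [AddCommGroup V] [Module (ZMod p) V] [Fintype V] [DecidableEq V],
    Fintype.card V = p ^ (t + 1) → ∀ A : Finset V, p ^ t < #A → #A ≤ p ^ (t + 1) →
      leeBound p t #A ≤ #(A - A) := by
  intro t
  induction t using Nat.strong_induction_on with
  | _ t ih =>
  intro V _ _ _ _ hV A hAt hAt1
  classical
  have hp2 : 2 ≤ p := hp.out.two_le
  have hAne : A.Nonempty := by rw [← card_pos]; exact lt_of_le_of_lt (Nat.zero_le _) hAt
  match t with
  | 0 =>
    -- `|V| = p`: Cauchy–Davenport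
    rw [zero_add, pow_one] at hV
    have h := one_dim hV A hAne
    rw [leeBound_def, pow_zero, one_mul, Nat.div_one, Nat.add_sub_cancel, min_comm]
    exact h
  | 1 =>
    have h := two_dim' hV A (by simpa using hAt)
    rw [leeBound_def, pow_one]
    exact h
  | s + 2 =>
    -- `|V| = p^{s+3}`, `d = s + 3 ≥ 3`: the hyperplane lemma
    haveI : Fintype (Module.Dual (ZMod p) V) := by
      haveI : Finite (Module.Dual (ZMod p) V) := Module.finite_of_finite (ZMod p)
      exact Fintype.ofFinite _
    set q := (#A + p ^ (s + 2) - 1) / p ^ (s + 2) with hq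
    set m := min (2 * q - 1) p with hm
    have h0 : (0 : V) ∈ A - A := by
      obtain ⟨a, ha⟩ := hAne
      simpa using sub_mem_sub ha ha
    have hppos : 0 < p := by omega
    -- fibres of a nonzero functional on `A`
    have hyp : ∀ f : Module.Dual (ZMod p) V, f ≠ 0 → m * p ^ (s + 1) ≤ #((A - A).filter fun x => f x = 0) := by
      intro f hf
      set q₁ := (#A + p - 1) / p with hq₁
      have hq₁p : q₁ * p ≤ #A + p - 1 := (Nat.le_div_iff_mul_le hppos).1 le_rfl
      -- a fibre of `f` with at least `q₁ = ⌈|A|/p⌉` points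
      have hfib : ∃ c : ZMod p, q₁ ≤ #(A.filter fun a => f a = c) := by
        by_contra hno
        have hno' : ∀ c : ZMod p, #(A.filter fun a => f a = c) ≤ q₁ - 1 := fun c => by
          by_contra h; exact hno ⟨c, by omega⟩
        have hsum := card_eq_sum_card_fiberwise (f := fun a : V => f a) (s := A)
          (t := (univ : Finset (ZMod p))) (fun _ _ => mem_coe.2 (mem_univ _))
        have : ∑ c ∈ (univ : Finset (ZMod p)), #(A.filter fun a => f a = c) ≤
            ∑ _c ∈ (univ : Finset (ZMod p)), (q₁ - 1) := Finset.sum_le_sum fun c _ => hno' c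
        rw [← hsum, sum_const, smul_eq_mul, card_univ, ZMod.card] at this
        have e1 : p * (q₁ - 1) = q₁ * p - p := by rw [Nat.mul_sub_one, mul_comm]
        rw [e1] at this
        have : 1 ≤ #A := card_pos.2 hAne
        omega
      obtain ⟨c, hc⟩ := hfib
      set Ac := A.filter fun a => f a = c with hAc
      have hAcne : Ac.Nonempty := by
        rw [← card_pos]
        have : 1 ≤ q₁ := by
          rw [hq₁, Nat.le_div_iff_mul_le hppos]
          have : 1 ≤ #A := card_pos.2 hAne
          omega
        omega
      obtain ⟨x₀, hx₀⟩ := hAcne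
      have hfx₀ : f x₀ = c := (mem_filter.1 hx₀).2
      -- translate into `ker f`
      set B := Ac.image fun a => a - x₀ with hB
      have hBcard : #B = #Ac := card_image_of_injective _ (sub_left_injective)
      have hBker : ∀ b ∈ B, b ∈ LinearMap.ker f := by
        intro b hb
        obtain ⟨a, ha, rfl⟩ := mem_image.1 hb
        rw [LinearMap.mem_ker, map_sub, (mem_filter.1 ha).2, hfx₀, sub_self]
      obtain ⟨B₀, hB₀B, hB₀card⟩ := exists_subset_card_eq (show q₁ ≤ #B by rw [hBcard]; exact hc)
      let B' : Finset (LinearMap.ker f) := B₀.subtype fun x => x ∈ LinearMap.ker f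
      have hB'card : #B' = q₁ := by
        rw [Finset.card_subtype, Finset.filter_true_of_mem fun x hx => hBker x (hB₀B hx), hB₀card]
      -- the induction hypothesis in the hyperplane `ker f`
      have hker : Fintype.card (LinearMap.ker f) = p ^ (s + 1 + 1) := card_ker hV hf
      have hq₁lo : p ^ (s + 1) < q₁ := by
        by_contra hle
        have hle' : q₁ ≤ p ^ (s + 1) := by omega
        have h' : #A ≤ p ^ (s + 1) * p := (ceilDiv_le_iff #A p (p ^ (s + 1)) hppos).1 hle'
        rw [← pow_succ] at h'
        change #A ≤ p ^ (s + 2) at h'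
        omega
      have hq₁hi : q₁ ≤ p ^ (s + 1 + 1) := by
        rw [hq₁, ceilDiv_le_iff _ _ _ hppos, ← pow_succ]
        exact hAt1
      have hIH := ih (s + 1) (by omega) hker B' (by rw [hB'card]; exact hq₁lo) (by rw [hB'card]; exact hq₁hi)
      -- `leeBound p (s+1) q₁ = m p^{s+1}`
      have hqq : (q₁ + p ^ (s + 1) - 1) / p ^ (s + 1) = q := by
        rw [hq₁, hq, ceilDiv_ceilDiv _ _ _ hppos (by positivity), ← pow_succ']
      rw [hB'card, leeBound_def, hqq, ← hm, mul_comm] at hIH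
      -- `B' − B'` maps into the fibre of `0`
      have hsub : (B' - B').image (Submodule.subtype (LinearMap.ker f)) ⊆ (A - A).filter fun x => f x = 0 := by
        intro y hy
        obtain ⟨z, hz, rfl⟩ := mem_image.1 hy
        obtain ⟨b₁, hb₁, b₂, hb₂, rfl⟩ := mem_sub.1 hz
        rw [Finset.mem_subtype] at hb₁ hb₂
        have hb₁B := hB₀B hb₁
        have hb₂B := hB₀B hb₂
        rw [hB] at hb₁B hb₂B
        obtain ⟨a₁, ha₁, hab₁⟩ := mem_image.1 hb₁B
        obtain ⟨a₂, ha₂, hab₂⟩ := mem_image.1 hb₂B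
        rw [mem_filter]
        refine ⟨?_, ?_⟩
        · rw [map_sub]
          change (b₁ : V) - (b₂ : V) ∈ A - A
          rw [← hab₁, ← hab₂, sub_sub_sub_cancel_right]
          exact sub_mem_sub (mem_filter.1 ha₁).1 (mem_filter.1 ha₂).1
        · rw [map_sub]
          change f ((b₁ : V) - (b₂ : V)) = 0
          have h1 : f (b₁ : V) = 0 := b₁.2
          have h2 : f (b₂ : V) = 0 := b₂.2
          rw [map_sub, h1, h2, sub_zero]
      calc m * p ^ (s + 1) ≤ #(B' - B') := hIH
        _ = #((B' - B').image (Submodule.subtype (LinearMap.ker f))) :=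
            (card_image_of_injective _ (Submodule.injective_subtype _)).symm
        _ ≤ #((A - A).filter fun x => f x = 0) := card_le_card hsub
    have hmain := le_card_of_forall_dual (p := p) s m hV (A - A) h0 hyp
    rw [leeBound_def, ← hq, ← hm, mul_comm]
    exact hmain

/-- **Lee 2018, Main Theorem — the lower bound, in every finite `𝔽_p`-vector space** (the reduction to
dimension `t + 1` is Lee's Lemma 2).  For `A ⊆ V` with `p^t < |A| ≤ p^{t+1}`:
`|A − A| ≥ p^t · min{2⌈|A|/p^t⌉ − 1, p}`. [cite: Lee2018, Thm (main) + Lemma 2] -/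
theorem leeBound_le_card_sub {V : Type*} [AddCommGroup V] [Module (ZMod p) V] [Fintype V] [DecidableEq V]
    (A : Finset V) (t : ℕ) (hAt : p ^ t < #A) (hAt1 : #A ≤ p ^ (t + 1)) : leeBound p t #A ≤ #(A - A) := by
  classical
  have hp2 : 2 ≤ p := hp.out.two_le
  -- `|V| = p^{t+1+k}`
  have hcard := card_eq_pow_finrank' (p := p) (W := V)
  have htd : t + 1 ≤ finrank (ZMod p) V := by
    have : p ^ t < p ^ finrank (ZMod p) V := by
      rw [← hcard]; exact lt_of_lt_of_le hAt (card_le_univ A)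
    exact (Nat.pow_lt_pow_iff_right (by omega)).1 this
  obtain ⟨k, hk⟩ : ∃ k, finrank (ZMod p) V = t + 1 + k := ⟨_, (Nat.add_sub_cancel' htd).symm⟩
  rw [hk] at hcard
  clear hk htd
  -- induction on the codimension `k`
  induction k generalizing V with
  | zero => exact core_dim t (by simpa using hcard) A hAt hAt1
  | succ k ihk =>
    have hAne : A.Nonempty := by rw [← card_pos]; exact lt_of_le_of_lt (Nat.zero_le _) hAt
    by_cases hbig : p ^ (t + 1) < #(A - A)
    · exact (leeBound_le_pow t #A).trans hbig.le
    · have hAA : #(A - A) ≤ p ^ (t + 1 + k) :=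
        (le_of_not_gt hbig).trans (Nat.pow_le_pow_right (by omega) (by omega))
      have h0 : (0 : V) ∈ A - A := by
        obtain ⟨a, ha⟩ := hAne
        simpa using sub_mem_sub ha ha
      have hV : Fintype.card V = p ^ (t + 1 + k + 1) := by rw [hcard, ← add_assoc]
      obtain ⟨v, hv0, hv⟩ := exists_smul_ne (p := p) (t + 1 + k) hV (A - A) h0 hAA
      let N := Submodule.span (ZMod p) {v}
      haveI : Fintype (V ⧸ N) := Fintype.ofFinite _
      have hW : Fintype.card (V ⧸ N) = p ^ (t + 1 + k) := card_quotient_span (p := p) (t + 1 + k) hV hv0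
      have hinj : Set.InjOn N.mkQ (A : Set V) := injOn_mkQ A hv
      set B : Finset (V ⧸ N) := A.image N.mkQ with hB
      have hBcard : #B = #A := card_image_of_injOn hinj
      have hBB : #(B - B) ≤ #(A - A) := by
        rw [hB, ← image_sub_of_addHom]
        exact card_image_le
      have h := ihk B (by rw [hBcard]; exact hAt) (by rw [hBcard]; exact hAt1) (by rw [hW])
      rw [hBcard] at h
      exact h.trans hBB

/-- **Lee 2018, Main Theorem — the bound is attained** (Lemma 1: the coset progressions of §3, tree lemma
`exists_card_sub_self_le_of_addSubgroup`).  For `p^t < r ≤ p^{t+1}` and `r ≤ |V|` some `r`-set `A ⊆ V` has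
`|A − A| ≤ p^t · min{2⌈r/p^t⌉ − 1, p}`. [cite: Lee2018, Lemma 1 + Thm (upper bound)] -/
theorem exists_card_sub_self_le_leeBound {V : Type*} [AddCommGroup V] [Module (ZMod p) V] [Fintype V]
    [DecidableEq V] {t r : ℕ} (hr : p ^ t < r) (hrt : r ≤ p ^ (t + 1)) (hrV : r ≤ Fintype.card V) :
    ∃ A : Finset V, #A = r ∧ #(A - A) ≤ leeBound p t r := by
  classical
  have hp2 : 2 ≤ p := hp.out.two_le
  have hppos : 0 < p ^ t := by positivity
  have hcard := card_eq_pow_finrank' (p := p) (W := V)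
  set d := finrank (ZMod p) V with hd
  have htd : t + 1 ≤ d := by
    have : p ^ t < p ^ d := by rw [← hcard]; exact lt_of_lt_of_le hr hrV
    exact (Nat.pow_lt_pow_iff_right (by omega)).1 this
  have hnat : Nat.card V = p ^ d := by rw [Nat.card_eq_fintype_card, hcard]
  -- `p • g = 0` for every `g`
  have hpg : ∀ g : V, p • g = 0 := fun g => by
    rw [← Nat.cast_smul_eq_nsmul (ZMod p), ZMod.natCast_self, zero_smul]
  set q := (r + p ^ t - 1) / p ^ t with hq
  have hrq : r ≤ q * p ^ t := (ceilDiv_le_iff r (p ^ t) q hppos).1 le_rfl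
  by_cases hsmall : 2 * q - 1 ≤ p
  · -- `c = q` cosets of a subgroup of order `p^t`
    obtain ⟨H, hH⟩ := Literature.GroupTheory.FiniteAbelian.exists_addSubgroup_card_eq_of_dvd_card V
      (show p ^ t ∣ Nat.card V by rw [hnat]; exact pow_dvd_pow p (by omega))
    -- an element outside `H`: its class has order `p ≥ q`
    have hHtop : ∃ g : V, g ∉ H := by
      by_contra hall
      have htop : H = ⊤ := by
        ext g; simpa using (show g ∈ H from by_contra fun h => hall ⟨g, h⟩)
      have : Nat.card H = Nat.card V := by rw [htop, AddSubgroup.card_top]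
      rw [hH, hnat] at this
      have : t < d := by omega
      exact absurd this (by rw [Nat.pow_right_injective hp2 ‹p ^ t = p ^ d›]; exact lt_irrefl _)
    obtain ⟨g, hg⟩ := hHtop
    have hord : addOrderOf (QuotientAddGroup.mk' H g) = p := by
      apply addOrderOf_eq_prime
      · rw [← map_nsmul, hpg, map_zero]
      · intro h
        exact hg ((QuotientAddGroup.eq_zero_iff g).1 h)
    have hq1 : 1 ≤ q := by
      rw [hq, Nat.le_div_iff_mul_le hppos]; omega
    obtain ⟨S, hS, hSS⟩ := exists_card_sub_self_le_of_addSubgroup H g hq1 (by rw [hord]; omega)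
      (show r ≤ q * Nat.card H by rw [hH]; exact hrq)
    refine ⟨S, hS, ?_⟩
    rw [leeBound_def, ← hq, min_eq_left hsmall, mul_comm]
    rw [hH] at hSS
    exact hSS
  · -- one coset of a subgroup of order `p^{t+1}`
    obtain ⟨H, hH⟩ := Literature.GroupTheory.FiniteAbelian.exists_addSubgroup_card_eq_of_dvd_card V
      (show p ^ (t + 1) ∣ Nat.card V by rw [hnat]; exact pow_dvd_pow p htd)
    obtain ⟨S, hS, hSS⟩ := exists_card_sub_self_le_of_addSubgroup H (0 : V) (c := 1) le_rfl
      (Nat.one_le_iff_ne_zero.2 (addOrderOf_pos _).ne') (show r ≤ 1 * Nat.card H by rw [hH]; omega)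
    refine ⟨S, hS, ?_⟩
    rw [leeBound_def, ← hq, min_eq_right (by omega), ← pow_succ]
    rw [hH] at hSS
    simpa using hSS

/-- **Lee 2018, Main Theorem (`G = (ℤ/p)^d`): `ρ⁻_G(r) = p^t · min{2⌈r/p^t⌉ − 1, p}` for
`p^t < r ≤ p^{t+1}`**, stated for every finite `𝔽_p`-vector space `V` (`|V| = p^d`, `r ≤ |V|`): every `r`-set
`A` has `|A − A| ≥ leeBound p t r`, and some `r`-set attains it.  With `ekpMu_le_card_sub_self` /
`exists_card_add_self_eq_ekpMu` of `OptimallySmallSumsets.lean` this exhibits `ρ⁻ > ρ⁺ = μ` (e.g. `(ℤ/3)²`,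
`r = 4`: `9 > 7`, Lee's Remark 2).  Lee's Conjecture 1 (the value of `ρ⁻_G` for other non-cyclic `G`) is
printed as open and is not formalised. [cite: Lee2018, Thm (main)] -/
theorem lee_main {V : Type*} [AddCommGroup V] [Module (ZMod p) V] [Fintype V] [DecidableEq V] {t r : ℕ}
    (hr : p ^ t < r) (hrt : r ≤ p ^ (t + 1)) (hrV : r ≤ Fintype.card V) :
    (∀ A : Finset V, #A = r → leeBound p t r ≤ #(A - A)) ∧
      ∃ A : Finset V, #A = r ∧ #(A - A) = leeBound p t r := by
  refine ⟨fun A hA => ?_, ?_⟩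
  · rw [← hA] at hr hrt ⊢
    exact leeBound_le_card_sub A t hr hrt
  · obtain ⟨A, hA, hle⟩ := exists_card_sub_self_le_leeBound (V := V) hr hrt hrV
    refine ⟨A, hA, le_antisymm hle ?_⟩
    rw [← hA] at hr hrt ⊢
    exact leeBound_le_card_sub A t hr hrt

/-- The Main Theorem for the coordinate space `(ℤ/p)^d = Fin d → ZMod p` (`t < d`). [cite: Lee2018, Thm (main)] -/
theorem lee_main_pi {d t r : ℕ} (htd : t < d) (hr : p ^ t < r) (hrt : r ≤ p ^ (t + 1)) :
    (∀ A : Finset (Fin d → ZMod p), #A = r → leeBound p t r ≤ #(A - A)) ∧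
      ∃ A : Finset (Fin d → ZMod p), #A = r ∧ #(A - A) = leeBound p t r := by
  apply lee_main hr hrt
  rw [Fintype.card_pi, Finset.prod_const, ZMod.card, card_univ, Fintype.card_fin]
  exact hrt.trans (Nat.pow_le_pow_right hp.out.pos htd)

/-- The lower bound for an arbitrary finite abelian group of exponent `p` (an elementary abelian `p`-group,
made an `𝔽_p`-space by `AddCommGroup.zmodModule`). [cite: Lee2018, Thm (main)] -/
theorem leeBound_le_card_sub_of_exponent {G : Type*} [AddCommGroup G] [Fintype G] [DecidableEq G]
    (hG : ∀ x : G, p • x = 0) (A : Finset G) (t : ℕ) (hAt : p ^ t < #A) (hAt1 : #A ≤ p ^ (t + 1)) :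
    leeBound p t #A ≤ #(A - A) := by
  letI : Module (ZMod p) G := AddCommGroup.zmodModule hG
  exact leeBound_le_card_sub A t hAt hAt1

end Main


end FewDifferences
end Literature.Combinatorics.Additive
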